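import Summits.QuantumFields.YangMills.Theorems.IR.Negative.TypOnsetFloorPoly.Poly

/-!
# CruxIdea2 (gen 9, negation lens) — the CEILING of the loop-freezing mechanism

Kernel objects for crux `BalabanLadder.IR` (item `stmt-QuantumFields-19354`), crux-ideate seat 2,
card `Cruxes/IR/Ideas/ym19354-2-frame-twist-row.md` §R (ladder «1/7 → 1/4 → …»).  Negation lens
turned on MY OWN ladder: what the loop-freezing engine of the polynomial row floor can NOT do.

**What is proved here (0 sorry, no new axioms).**  A finite-volume, non-abelian, `1/β`-rate
PERIMETER-LAW UPPER BOUND for the rectangle Wilson loop of the row-floor construction, and from it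
the CEILING `θ ≤ 1` of the input `RowFloorPoly.LoopFreezingPoly ρ n θ` of the landed polynomial
row floor (`Theorems/IR/Negative/TypOnsetFloorPoly/Poly.lean`, referred to BY NAME):

* §A `norm_act_condMean_le` — ONE-LINK ANTI-CONCENTRATION: for a continuous unitary `π` of a
  compact group `Γ` with right-invariant probability `ν`, a continuous positive weight `w` whose
  symmetric second difference is controlled along `k`, `e^{-K} w(g)² ≤ w(gk) w(gk⁻¹)`, where `k`
  MOVES the vector `x` (`a‖x‖ ≤ ‖π(k)x − x‖`), the tilted mean `M = ∫ π w dν / ∫ w dν` contracts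
  `x`: `‖M x‖ ≤ (1 − a² e^{−K/2} / 24) ‖x‖` (variance identity + AM–GM transport of mass by right
  multiplication with `k^{±1}`; no Lie structure, no spectral gap, no cluster expansion).
* §B `linkMean_isContr` — for the single-link Wilson DLR kernel at inverse coupling `β ≥ 1` under
  the Lie-free mobility hypothesis `MobilePairs ρ a₀ K₀` (scale `t = 1/√β`; the `β`-weighted
  action has second difference `≤ 30·N·K₀` since a link lies in `≤ 30` plaquette slots of `ℤ⁴`,
  `card_plaquettesTouching_singleton_le`): the conditional mean of `ρ(U_e)` given everything else
  is a contraction by `1 − c/(2β)`, `c = ceilC N a₀ K₀ = min (a₀² e^{−15 N K₀} / 12) 1`, uniformly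
  in the boundary condition.
* §B `integral_loopObs_torus_le_pow` — integrating the `m = (2n+1)b` links of the top run of the
  `b × m` rectangle one at a time against their single-link DLR kernels on the torus of side
  `L_b = 2((2n+2)b+1)+1` (tree `integral_torusLift_eq_integral_ymSpecification`; the collars of
  distinct top links do not contain each other, `topLink_not_mem_collar`, so the iterated kernel has
  the closed form `Fcl`): `E_{μ_{L_b,β}} W_{b×(2n+1)b} ≤ (1 − c/(2β))^{(2n+1)b}` for all `β ≥ 1`,
  `b ≥ 1`.
* §C `not_loopFreezingPoly_of_one_lt` / `loopFreezingPoly_exponent_le_one` — hence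
  `LoopFreezingPoly ρ n θ` FAILS for every `θ > 1` (take `η = 1/2`, `b = ⌊c₁ (β/log β)^θ⌋`, and
  `(1 − c/2β)^{(2n+1)b} ≤ e^{−c b/2β} ≤ e^{−1} < 1/2` for `β` large since `θ > 1`): the freezing
  input of the row floor saturates at loop sizes `b = O(β)` up to the logarithm, i.e. the ladder of
  CruxIdea2 cannot be climbed past `θ = 1` with annealed loop freezing as its engine (THE NUMBER
  §A″(6) «b⋆ ~ β is the reach of freezing [heur]» ↦ [tree], for mobile `ρ`).  Together with the tree's
  `RowFloorPoly.loopFreezingPoly_mono` the admissible exponents form a down-set inside `(-∞, 1]`.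
* §D `mobilePairs_u1Rep` — ANTI-VACUITY of the hypothesis: the defining representation of `U(1)`
  has `MobilePairs u1Rep (2/π) 1` (`|e^{it} − 1| = 2 sin(t/2) ≥ (2/π)t`, `|2cos t − 2| ≤ t²`).
  (Expected, not proved here: every continuous unitary `ρ` of a compact connected Lie group with no
  `ρ`-invariant vector is mobile, via one-parameter subgroups; `MobilePairs` is FALSE for finite `G`
  — correctly, since discrete gauge groups freeze up to `b ~ e^{cβ}`,
  `Literature/Barriers/QuantumFields/DiscreteSubgroupFreezing.lean`.)

**What this is NOT.**  Finite volume (the torus `μ_{L_b,β}` of the row-floor construction), an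
UPPER bound on a Wilson loop expectation: it says nothing about area law, mass gap, `IR` itself or
the continuum limit, and it does not touch the slot of record (`Lines/af_pincer_Uc_sharp.lean`).  It
is a theorem about the REACH of one proof mechanism: any floor `b⋆(β) ≳ β^{1+δ}` must be fed by an
input other than annealed loop freezing.

Nearest literature: Simon–Yaffe 1982 (perimeter-law upper bound with rate `e^{−O(β)}`, transfer
matrix, infinite volume; sharp for finite groups) [SimonYaffe1982, eqs. (12)–(14)]; Garban–Sepúlveda
2023, Thm 3 (abelian Villain `U(1)₄`, rate `C_GFF/2β`) [arXiv:2107.04021].  The present crude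
non-abelian finite-volume `1/β` bound (constant `c(ρ)/2`, no attempt at sharpness) is presumably
folklore ("spin-wave perimeter law"); not located in print in this form (corpus fts+vec and galaxy,
queries in the seat's NOTES).
-/

open MeasureTheory Literature.MathematicalPhysics.QuantumLattice Literature.Probability.LatticeModels
open Literature.MathematicalPhysics.QuantumFieldTheory (haarProbability wilsonMeasure GaugeConfig
  isProbabilityMeasure_wilsonMeasure measurable_torusLift)
open scoped InnerProductSpace

namespace Summit.QuantumFields.YangMills.Cruxes.IR.CruxIdea2g9

/-! ## §0. Vector toolkit: matrices acting on `ℂ^N = EuclideanSpace ℂ (Fin N)` -/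

section Toolkit

variable {N : ℕ}

/-- The action of a matrix on Euclidean `ℂ^N`. -/
noncomputable def act (A : Matrix (Fin N) (Fin N) ℂ) (x : EuclideanSpace ℂ (Fin N)) :
    EuclideanSpace ℂ (Fin N) :=
  WithLp.toLp 2 (A.mulVec (WithLp.ofLp x))

theorem act_apply (A : Matrix (Fin N) (Fin N) ℂ) (x : EuclideanSpace ℂ (Fin N)) (i : Fin N) :
    act A x i = ∑ j, A i j * x j := rfl

theorem act_mul (A B : Matrix (Fin N) (Fin N) ℂ) (x : EuclideanSpace ℂ (Fin N)) :
    act (A * B) x = act A (act B x) := by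
  simp [act, Matrix.mulVec_mulVec]

@[simp] theorem act_one (x : EuclideanSpace ℂ (Fin N)) : act 1 x = x := by
  simp [act]

theorem act_add (A : Matrix (Fin N) (Fin N) ℂ) (x y : EuclideanSpace ℂ (Fin N)) :
    act A (x + y) = act A x + act A y := by
  simp [act, Matrix.mulVec_add]

theorem act_sub (A : Matrix (Fin N) (Fin N) ℂ) (x y : EuclideanSpace ℂ (Fin N)) :
    act A (x - y) = act A x - act A y := by
  simp [act, Matrix.mulVec_sub]

theorem add_act (A B : Matrix (Fin N) (Fin N) ℂ) (x : EuclideanSpace ℂ (Fin N)) :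
    act (A + B) x = act A x + act B x := by
  simp [act, Matrix.add_mulVec]

theorem sub_act (A B : Matrix (Fin N) (Fin N) ℂ) (x : EuclideanSpace ℂ (Fin N)) :
    act (A - B) x = act A x - act B x := by
  simp [act, Matrix.sub_mulVec]

theorem smul_act (c : ℂ) (A : Matrix (Fin N) (Fin N) ℂ) (x : EuclideanSpace ℂ (Fin N)) :
    act (c • A) x = c • act A x := by
  simp [act, Matrix.smul_mulVec]

/-- `⟪y, A x⟫ = ∑ᵢⱼ A i j · x j · conj (y i)` (linear in `A`). -/
theorem inner_act_eq_sum (A : Matrix (Fin N) (Fin N) ℂ) (x y : EuclideanSpace ℂ (Fin N)) :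
    ⟪y, act A x⟫_ℂ = ∑ i, ∑ j, A i j * (x j * (starRingEnd ℂ) (y i)) := by
  simp only [EuclideanSpace.inner_eq_star_dotProduct, act, dotProduct, Matrix.mulVec,
    Pi.star_apply, RCLike.star_def, Finset.sum_mul]
  refine Finset.sum_congr rfl fun i _ => Finset.sum_congr rfl fun j _ => ?_
  ring

/-- Inner products are preserved by unitary matrices. -/
theorem inner_act_act {A : Matrix (Fin N) (Fin N) ℂ} (hA : A ∈ Matrix.unitaryGroup (Fin N) ℂ)
    (x y : EuclideanSpace ℂ (Fin N)) : ⟪act A x, act A y⟫_ℂ = ⟪x, y⟫_ℂ := by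
  have h : star A * A = 1 := Matrix.mem_unitaryGroup_iff'.1 hA
  simp only [EuclideanSpace.inner_eq_star_dotProduct, act]
  rw [Matrix.star_mulVec, dotProduct_comm, Matrix.dotProduct_mulVec, Matrix.vecMul_vecMul,
    ← Matrix.star_eq_conjTranspose, h, Matrix.vecMul_one, dotProduct_comm]

/-- Unitary matrices act isometrically. -/
theorem norm_act_of_unitary {A : Matrix (Fin N) (Fin N) ℂ} (hA : A ∈ Matrix.unitaryGroup (Fin N) ℂ)
    (x : EuclideanSpace ℂ (Fin N)) : ‖act A x‖ = ‖x‖ := by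
  have h1 : ‖act A x‖ ^ 2 = ‖x‖ ^ 2 := by
    rw [@norm_sq_eq_re_inner ℂ, @norm_sq_eq_re_inner ℂ, inner_act_act hA]
  nlinarith [norm_nonneg (act A x), norm_nonneg x, sq_nonneg (‖act A x‖ - ‖x‖),
    sq_nonneg (‖act A x‖ + ‖x‖)]

/-- `A` contracts Euclidean norms by the factor `θ`. -/
def IsContr (A : Matrix (Fin N) (Fin N) ℂ) (θ : ℝ) : Prop :=
  ∀ x : EuclideanSpace ℂ (Fin N), ‖act A x‖ ≤ θ * ‖x‖

theorem isContr_of_unitary {A : Matrix (Fin N) (Fin N) ℂ} (hA : A ∈ Matrix.unitaryGroup (Fin N) ℂ) :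
    IsContr A 1 := fun x => by rw [norm_act_of_unitary hA, one_mul]

theorem IsContr.nonneg_of_ne {A : Matrix (Fin N) (Fin N) ℂ} {θ : ℝ} (h : IsContr A θ)
    {x : EuclideanSpace ℂ (Fin N)} (hx : x ≠ 0) : 0 ≤ θ := by
  have := (norm_nonneg _).trans (h x)
  exact nonneg_of_mul_nonneg_left this (norm_pos_iff.2 hx)

theorem IsContr.mono {A : Matrix (Fin N) (Fin N) ℂ} {θ θ' : ℝ} (h : IsContr A θ) (hθ : θ ≤ θ') :
    IsContr A θ' := fun x => (h x).trans (mul_le_mul_of_nonneg_right hθ (norm_nonneg _))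

theorem IsContr.mul {A B : Matrix (Fin N) (Fin N) ℂ} {θ θ' : ℝ} (hA : IsContr A θ) (hB : IsContr B θ')
    (hθ : 0 ≤ θ) : IsContr (A * B) (θ * θ') := fun x => by
  rw [act_mul, mul_assoc]
  exact (hA _).trans (mul_le_mul_of_nonneg_left (hB x) hθ)

/-- A product of `θ`-contractions (`θ ≥ 0`) is a `θ ^ length`-contraction. -/
theorem isContr_list_prod {θ : ℝ} (hθ : 0 ≤ θ) :
    ∀ l : List (Matrix (Fin N) (Fin N) ℂ), (∀ A ∈ l, IsContr A θ) → IsContr l.prod (θ ^ l.length)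
  | [], _ => fun x => by simp
  | A :: l, h => by
      rw [List.prod_cons, List.length_cons, pow_succ']
      exact (h A (by simp)).mul (isContr_list_prod hθ l fun B hB => h B (by simp [hB])) hθ

/-- Entries of a `θ`-contraction have modulus `≤ θ`. -/
theorem norm_entry_le_of_isContr {A : Matrix (Fin N) (Fin N) ℂ} {θ : ℝ} (h : IsContr A θ) (i j : Fin N) :
    ‖A i j‖ ≤ θ := by
  have h1 : act A (EuclideanSpace.single j (1 : ℂ)) i = A i j := by
    rw [act_apply]
    simp [Finset.sum_ite_eq']
  have h2 : ‖act A (EuclideanSpace.single j (1 : ℂ)) i‖ ≤ ‖act A (EuclideanSpace.single j (1 : ℂ))‖ :=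
    PiLp.norm_apply_le _ i
  rw [h1] at h2
  refine h2.trans ((h _).trans ?_)
  simp

/-- The trace of a `θ`-contraction: `|Re tr A| ≤ N θ`. -/
theorem abs_re_trace_le_of_isContr {A : Matrix (Fin N) (Fin N) ℂ} {θ : ℝ} (h : IsContr A θ) :
    |A.trace.re| ≤ N * θ := by
  calc |A.trace.re| ≤ ‖A.trace‖ := Complex.abs_re_le_norm _
    _ = ‖∑ k, A k k‖ := rfl
    _ ≤ ∑ k, ‖A k k‖ := norm_sum_le _ _
    _ ≤ ∑ _k : Fin N, θ := Finset.sum_le_sum fun k _ => norm_entry_le_of_isContr h k k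
    _ = N * θ := by simp

/-- `|Re (tr A / N)| ≤ θ` for a `θ`-contraction, `θ ≥ 0`. -/
theorem abs_re_trace_div_le_of_isContr {A : Matrix (Fin N) (Fin N) ℂ} {θ : ℝ} (h : IsContr A θ)
    (hθ : 0 ≤ θ) : |(A.trace / (N : ℂ)).re| ≤ θ := by
  have hre : (A.trace / (N : ℂ)).re = A.trace.re / N := by
    rw [show (N : ℂ) = ((N : ℝ) : ℂ) by simp, Complex.div_ofReal_re]
  rw [hre]
  rcases Nat.eq_zero_or_pos N with hN | hN
  · subst hN; simpa using hθ
  · rw [abs_div, Nat.abs_cast, div_le_iff₀ (by exact_mod_cast hN)]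
    simpa [mul_comm] using abs_re_trace_le_of_isContr h

/-- From a quadratic deficit to a linear contraction factor: `‖y‖² ≤ (1 − u)‖x‖²`, `0 ≤ u`, gives
`‖y‖ ≤ (1 − u/2)‖x‖`. -/
theorem norm_le_of_sq_le {x y : EuclideanSpace ℂ (Fin N)} {u : ℝ} (_hu : 0 ≤ u)
    (h : ‖y‖ ^ 2 ≤ (1 - u) * ‖x‖ ^ 2) : ‖y‖ ≤ (1 - u / 2) * ‖x‖ := by
  by_cases hx : x = 0
  · subst hx
    have : ‖y‖ ^ 2 ≤ 0 := by simpa using h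
    have hy : ‖y‖ = 0 := by nlinarith [norm_nonneg y]
    simp [hy]
  · have hxp : 0 < ‖x‖ := norm_pos_iff.2 hx
    have hu1 : u ≤ 1 := by
      by_contra hu1
      have : (1 - u) * ‖x‖ ^ 2 < 0 := mul_neg_of_neg_of_pos (by linarith) (by positivity)
      nlinarith [norm_nonneg y]
    have h2 : ‖y‖ ^ 2 ≤ ((1 - u / 2) * ‖x‖) ^ 2 := by nlinarith [sq_nonneg (u * ‖x‖)]
    exact (pow_le_pow_iff_left₀ (norm_nonneg _) (by nlinarith) two_ne_zero).1 h2

end Toolkit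

/-! ## §A. One-link anti-concentration (abstract: a unitary representation of a group with a
right-invariant finite measure and a log-quasi-invariant positive weight) -/

section AntiConcentration

variable {N : ℕ} {Γ : Type*} [Group Γ] [MeasurableSpace Γ]

/-- AM–GM transport step: `E² u² ≤ v v'` with everything nonnegative gives `2 E u ≤ v + v'`. -/
theorem two_mul_le_add_of_sq_le {u v v' E : ℝ} (_hu : 0 ≤ u) (hv : 0 ≤ v) (hv' : 0 ≤ v') (_hE : 0 ≤ E)
    (h : E ^ 2 * u ^ 2 ≤ v * v') : 2 * E * u ≤ v + v' := by
  by_contra hlt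
  push Not at hlt
  have h1 : (v + v') ^ 2 < (2 * E * u) ^ 2 := by
    have := mul_self_lt_mul_self (by positivity : 0 ≤ v + v') hlt
    nlinarith
  nlinarith [sq_nonneg (v - v')]

/-- The pointwise inequality behind the anti-concentration bound. -/
theorem pointwise_antiConc {φ φ₁ φ₂ u v v' δ E : ℝ} (hφ : 0 ≤ φ) (hφ₁ : 0 ≤ φ₁) (hφ₂ : 0 ≤ φ₂)
    (hu : 0 ≤ u) (hv : 0 ≤ v) (hv' : 0 ≤ v') (hδ : 0 ≤ δ) (hE0 : 0 ≤ E) (hE1 : E ≤ 1)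
    (h1 : δ ≤ φ + φ₁) (h2 : δ ≤ φ + φ₂) (hw : E ^ 2 * u ^ 2 ≤ v * v') :
    δ ^ 2 * E / 4 * u ≤ φ ^ 2 * u + φ₁ ^ 2 * v + φ₂ ^ 2 * v' := by
  have hvv : 2 * E * u ≤ v + v' := two_mul_le_add_of_sq_le hu hv hv' hE0 hw
  by_cases hc : δ / 2 ≤ φ
  · have h3 : δ ^ 2 / 4 ≤ φ ^ 2 := by nlinarith
    have h4 : δ ^ 2 * E / 4 * u ≤ δ ^ 2 / 4 * u := by
      have : δ ^ 2 * E ≤ δ ^ 2 := by nlinarith [sq_nonneg δ]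
      nlinarith
    nlinarith [mul_nonneg (sq_nonneg φ₁) hv, mul_nonneg (sq_nonneg φ₂) hv', mul_le_mul_of_nonneg_right h3 hu]
  · push Not at hc
    have h5 : δ / 2 ≤ φ₁ := by linarith
    have h6 : δ / 2 ≤ φ₂ := by linarith
    have h7 : δ ^ 2 / 4 ≤ φ₁ ^ 2 := by nlinarith
    have h8 : δ ^ 2 / 4 ≤ φ₂ ^ 2 := by nlinarith
    have h9 : δ ^ 2 / 4 * (v + v') ≤ φ₁ ^ 2 * v + φ₂ ^ 2 * v' := by
      nlinarith [mul_le_mul_of_nonneg_right h7 hv, mul_le_mul_of_nonneg_right h8 hv']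
    have h10 : δ ^ 2 * E / 4 * u ≤ δ ^ 2 / 4 * (v + v') := by
      have : δ ^ 2 / 4 * (2 * E * u) ≤ δ ^ 2 / 4 * (v + v') :=
        mul_le_mul_of_nonneg_left hvv (by positivity)
      nlinarith [sq_nonneg δ, mul_nonneg (mul_nonneg (sq_nonneg δ) hE0) hu]
    nlinarith [mul_nonneg (sq_nonneg φ) hu]

variable [MeasurableMul Γ] (ν : Measure Γ) [ν.IsMulRightInvariant]

/-- **Anti-concentration by AM–GM transport.** If `δ ≤ f(g) + f(gk)` and `δ ≤ f(g) + f(gk⁻¹)`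
pointwise and the weight satisfies `e^{−K} w(g)² ≤ w(gk) w(gk⁻¹)`, then
`(δ² e^{−K/2} / 12) ∫ w ≤ ∫ f² w` (right-invariance of `ν`; no Lie structure, no sets). -/
theorem integral_sq_mul_ge {f w : Γ → ℝ} (hf : ∀ g, 0 ≤ f g) (hw : ∀ g, 0 ≤ w g)
    (hwi : Integrable w ν) (hfw : Integrable (fun g => f g ^ 2 * w g) ν) (k : Γ) {δ K : ℝ}
    (hδ : 0 ≤ δ) (hK : 0 ≤ K) (h1 : ∀ g, δ ≤ f g + f (g * k)) (h2 : ∀ g, δ ≤ f g + f (g * k⁻¹))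
    (hwk : ∀ g, Real.exp (-K) * w g ^ 2 ≤ w (g * k) * w (g * k⁻¹)) :
    δ ^ 2 * Real.exp (-K / 2) / 12 * ∫ g, w g ∂ν ≤ ∫ g, f g ^ 2 * w g ∂ν := by
  set E := Real.exp (-K / 2) with hE
  have hE0 : 0 ≤ E := (Real.exp_pos _).le
  have hE1 : E ≤ 1 := by rw [hE]; exact Real.exp_le_one_iff.2 (by linarith)
  have hEK : Real.exp (-K) = E ^ 2 := by
    rw [hE, sq, ← Real.exp_add]; ring_nf
  have hI1 : ∫ g, f (g * k) ^ 2 * w (g * k) ∂ν = ∫ g, f g ^ 2 * w g ∂ν :=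
    integral_mul_right_eq_self (fun g => f g ^ 2 * w g) k
  have hI2 : ∫ g, f (g * k⁻¹) ^ 2 * w (g * k⁻¹) ∂ν = ∫ g, f g ^ 2 * w g ∂ν :=
    integral_mul_right_eq_self (fun g => f g ^ 2 * w g) k⁻¹
  have hi1 : Integrable (fun g => f (g * k) ^ 2 * w (g * k)) ν := hfw.comp_mul_right k
  have hi2 : Integrable (fun g => f (g * k⁻¹) ^ 2 * w (g * k⁻¹)) ν := hfw.comp_mul_right k⁻¹
  have hi12 : Integrable (fun g => f g ^ 2 * w g + f (g * k) ^ 2 * w (g * k)) ν := hfw.add hi1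
  have hsum : ∫ g, (f g ^ 2 * w g + f (g * k) ^ 2 * w (g * k) + f (g * k⁻¹) ^ 2 * w (g * k⁻¹)) ∂ν =
      3 * ∫ g, f g ^ 2 * w g ∂ν := by
    rw [integral_add hi12 hi2, integral_add hfw hi1, hI1, hI2]; ring
  have hmono : ∫ g, δ ^ 2 * E / 4 * w g ∂ν ≤
      ∫ g, (f g ^ 2 * w g + f (g * k) ^ 2 * w (g * k) + f (g * k⁻¹) ^ 2 * w (g * k⁻¹)) ∂ν := by
    refine integral_mono (hwi.const_mul _) (hi12.add hi2) fun g => ?_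
    have := pointwise_antiConc (hf g) (hf (g * k)) (hf (g * k⁻¹)) (hw g) (hw (g * k)) (hw (g * k⁻¹))
      hδ hE0 hE1 (h1 g) (h2 g) (by rw [← hEK]; exact hwk g)
    simpa using this
  rw [integral_const_mul, hsum] at hmono
  linarith

variable (π : Γ →* Matrix (Fin N) (Fin N) ℂ)

/-- The tilted mean `M = (∫ π(g) w(g) dν) / ∫ w dν` (entrywise). -/
noncomputable def condMean (w : Γ → ℝ) : Matrix (Fin N) (Fin N) ℂ :=
  fun i j => (∫ g, π g i j * (w g : ℂ) ∂ν) / ((∫ g, w g ∂ν : ℝ) : ℂ)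

omit [MeasurableMul Γ] [ν.IsMulRightInvariant] in
/-- Linearity: `∫ ⟪y, π(g) x⟫ w(g) dν = (∫ w) · ⟪y, M x⟫`. -/
theorem integral_inner_act_mul (w : Γ → ℝ) (hint : ∀ i j, Integrable (fun g => π g i j * (w g : ℂ)) ν)
    (hZ : (∫ g, w g ∂ν) ≠ 0) (x y : EuclideanSpace ℂ (Fin N)) :
    ∫ g, ⟪y, act (π g) x⟫_ℂ * (w g : ℂ) ∂ν = ((∫ g, w g ∂ν : ℝ) : ℂ) * ⟪y, act (condMean ν π w) x⟫_ℂ := by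
  have hZ' : ((∫ g, w g ∂ν : ℝ) : ℂ) ≠ 0 := by exact_mod_cast hZ
  have h1 : ∀ i j, ∫ g, π g i j * (x j * (starRingEnd ℂ) (y i)) * (w g : ℂ) ∂ν =
      (∫ g, π g i j * (w g : ℂ) ∂ν) * (x j * (starRingEnd ℂ) (y i)) := by
    intro i j
    rw [← integral_mul_const]
    exact integral_congr_ae (Filter.Eventually.of_forall fun g => by ring)
  have h2 : ∀ i j, Integrable (fun g => π g i j * (x j * (starRingEnd ℂ) (y i)) * (w g : ℂ)) ν := by
    intro i j
    exact ((hint i j).mul_const (x j * (starRingEnd ℂ) (y i))).congr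
      (Filter.Eventually.of_forall fun g => by ring)
  have h3 : ∀ i, Integrable (fun g => ∑ j, π g i j * (x j * (starRingEnd ℂ) (y i)) * (w g : ℂ)) ν :=
    fun i => integrable_finsetSum _ fun j _ => h2 i j
  simp only [inner_act_eq_sum, Finset.sum_mul, condMean]
  rw [integral_finsetSum _ fun i _ => h3 i, Finset.mul_sum]
  refine Finset.sum_congr rfl fun i _ => ?_
  rw [integral_finsetSum _ fun j _ => h2 i j, Finset.mul_sum]
  refine Finset.sum_congr rfl fun j _ => ?_
  rw [h1 i j]
  field_simp

omit [MeasurableMul Γ] [ν.IsMulRightInvariant] in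
/-- `∫ Re(tr(P π(g) Q)/N) w dν = (∫ w dν) · Re(tr(P M Q)/N)` with `M` the `w`-tilted mean of `π`. -/
theorem integral_re_trace_mul (w : Γ → ℝ) (hint : ∀ i j, Integrable (fun g => π g i j * (w g : ℂ)) ν)
    (hZ : (∫ g, w g ∂ν) ≠ 0) (P Q : Matrix (Fin N) (Fin N) ℂ)
    (htr : Integrable (fun g => (P * π g * Q).trace * (w g : ℂ)) ν) :
    ∫ g, ((P * π g * Q).trace / (N : ℂ)).re * w g ∂ν =
      (∫ g, w g ∂ν) * ((P * condMean ν π w * Q).trace / (N : ℂ)).re := by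
  have key : ∫ g, (P * π g * Q).trace * (w g : ℂ) ∂ν =
      ((∫ g, w g ∂ν : ℝ) : ℂ) * (P * condMean ν π w * Q).trace := by
    have hZ' : ((∫ g, w g ∂ν : ℝ) : ℂ) ≠ 0 := by exact_mod_cast hZ
    have htr' : ∀ A : Matrix (Fin N) (Fin N) ℂ,
        (P * A * Q).trace = ∑ i, ∑ l, ∑ j, P i j * A j l * Q l i := by
      intro A
      simp only [Matrix.trace, Matrix.diag, Matrix.mul_apply, Finset.sum_mul]
    have h2 : ∀ i l j, Integrable (fun g => P i j * π g j l * Q l i * (w g : ℂ)) ν := by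
      intro i l j
      exact (((hint j l).const_mul (P i j)).mul_const (Q l i)).congr
        (Filter.Eventually.of_forall fun g => by ring)
    have h1 : ∀ i l j, ∫ g, P i j * π g j l * Q l i * (w g : ℂ) ∂ν =
        P i j * (∫ g, π g j l * (w g : ℂ) ∂ν) * Q l i := by
      intro i l j
      rw [← integral_const_mul, ← integral_mul_const]
      exact integral_congr_ae (Filter.Eventually.of_forall fun g => by ring)
    simp only [htr', Finset.sum_mul, condMean]
    rw [integral_finsetSum _ fun i _ => ?_, Finset.mul_sum]
    · refine Finset.sum_congr rfl fun i _ => ?_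
      rw [integral_finsetSum _ fun l _ => ?_, Finset.mul_sum]
      · refine Finset.sum_congr rfl fun l _ => ?_
        rw [integral_finsetSum _ fun j _ => h2 i l j, Finset.mul_sum]
        refine Finset.sum_congr rfl fun j _ => ?_
        rw [h1 i l j]
        field_simp
      · exact integrable_finsetSum _ fun j _ => h2 i l j
    · exact integrable_finsetSum _ fun l _ => integrable_finsetSum _ fun j _ => h2 i l j
  have hre : ∀ g, ((P * π g * Q).trace / (N : ℂ)).re * w g =
      ((P * π g * Q).trace * (w g : ℂ)).re / N := by
    intro g
    rw [show (N : ℂ) = ((N : ℝ) : ℂ) by simp, Complex.div_ofReal_re, Complex.re_mul_ofReal]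
    ring
  simp_rw [hre]
  rw [integral_div]
  have h3 := integral_re htr
  simp only [RCLike.re_to_complex] at h3
  rw [h3, key, Complex.re_ofReal_mul, show (N : ℂ) = ((N : ℝ) : ℂ) by simp, Complex.div_ofReal_re]
  ring

omit [MeasurableMul Γ] [ν.IsMulRightInvariant] in
/-- The variance identity `∫ ‖π(g)x − Mx‖² w dν = (∫ w)(‖x‖² − ‖Mx‖²)` for unitary `π`. -/
theorem integral_norm_sub_sq_mul (hπu : ∀ g, π g ∈ Matrix.unitaryGroup (Fin N) ℂ) (w : Γ → ℝ)
    (hwi : Integrable w ν) (hint : ∀ i j, Integrable (fun g => π g i j * (w g : ℂ)) ν)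
    (hZ : (∫ g, w g ∂ν) ≠ 0) (x : EuclideanSpace ℂ (Fin N))
    (hi : Integrable (fun g => ⟪act (condMean ν π w) x, act (π g) x⟫_ℂ * (w g : ℂ)) ν) :
    ∫ g, ‖act (π g) x - act (condMean ν π w) x‖ ^ 2 * w g ∂ν =
      (∫ g, w g ∂ν) * (‖x‖ ^ 2 - ‖act (condMean ν π w) x‖ ^ 2) := by
  set M := condMean ν π w with hM
  have hpt : ∀ g, ‖act (π g) x - act M x‖ ^ 2 * w g =
      (‖x‖ ^ 2 + ‖act M x‖ ^ 2) * w g - 2 * (⟪act M x, act (π g) x⟫_ℂ * (w g : ℂ)).re := by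
    intro g
    rw [@norm_sub_sq ℂ, norm_act_of_unitary (hπu g), ← inner_re_symm (𝕜 := ℂ)]
    simp only [Complex.re_mul_ofReal, RCLike.re_to_complex]
    ring
  simp_rw [hpt]
  have hire : Integrable (fun g => (⟪act M x, act (π g) x⟫_ℂ * (w g : ℂ)).re) ν := by
    simpa only [RCLike.re_to_complex] using hi.re
  have hA : Integrable (fun g => (‖x‖ ^ 2 + ‖act M x‖ ^ 2) * w g) ν := hwi.const_mul _
  have hB : Integrable (fun g => 2 * (⟪act M x, act (π g) x⟫_ℂ * (w g : ℂ)).re) ν := hire.const_mul _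
  rw [integral_sub hA hB, integral_const_mul, integral_const_mul]
  have hre : ∫ g, (⟪act M x, act (π g) x⟫_ℂ * (w g : ℂ)).re ∂ν =
      (∫ g, ⟪act M x, act (π g) x⟫_ℂ * (w g : ℂ) ∂ν).re := by
    simpa only [RCLike.re_to_complex] using integral_re hi
  rw [hre, integral_inner_act_mul ν π w hint hZ, ← hM]
  simp only [Complex.mul_re, Complex.ofReal_re, Complex.ofReal_im, zero_mul, sub_zero]
  have hn : (⟪act M x, act M x⟫_ℂ).re = ‖act M x‖ ^ 2 := by
    rw [@norm_sq_eq_re_inner ℂ]; rfl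
  rw [hn]
  ring

/-- Continuous functions on a compact space are integrable for a finite measure. -/
theorem integrable_of_continuous_compact {X E : Type*} [TopologicalSpace X] [CompactSpace X]
    [MeasurableSpace X] [OpensMeasurableSpace X] (μ : Measure X) [IsFiniteMeasure μ]
    [NormedAddCommGroup E] [SecondCountableTopologyEither X E] {f : X → E} (hf : Continuous f) :
    Integrable f μ := by
  obtain ⟨C, hC⟩ := isCompact_univ.exists_bound_of_continuousOn hf.continuousOn
  exact Integrable.mono' (integrable_const C) hf.aestronglyMeasurable
    (ae_of_all _ fun x => hC x (Set.mem_univ x))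

variable [TopologicalSpace Γ] [OpensMeasurableSpace Γ] [CompactSpace Γ] [IsFiniteMeasure ν]

omit [MeasurableSpace Γ] [MeasurableMul Γ] [ν.IsMulRightInvariant] [OpensMeasurableSpace Γ] [CompactSpace Γ]
  [IsFiniteMeasure ν] in
theorem continuous_act_rep (hπc : Continuous (π : Γ → Matrix (Fin N) (Fin N) ℂ))
    (z : EuclideanSpace ℂ (Fin N)) : Continuous fun g => act (π g) z :=
  (PiLp.continuous_toLp 2 _).comp (hπc.matrix_mulVec continuous_const)

/-- **One-link anti-concentration ⇒ contraction of the tilted mean.**  For a continuous unitary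
representation `π` of a compact group `Γ` (right-invariant finite measure `ν`), a continuous
positive weight `w` with `e^{−K} w(g)² ≤ w(gk) w(gk⁻¹)`, and a vector `x` MOVED by `k`
(`a‖x‖ ≤ ‖π(k)x − x‖`): `‖M x‖ ≤ (1 − a² e^{−K/2}/24) ‖x‖`, `M = ∫ π w dν / ∫ w dν`. -/
theorem norm_act_condMean_le (hπc : Continuous (π : Γ → Matrix (Fin N) (Fin N) ℂ))
    (hπu : ∀ g, π g ∈ Matrix.unitaryGroup (Fin N) ℂ) {w : Γ → ℝ} (hwc : Continuous w)
    (hw0 : ∀ g, 0 < w g) (hZ : 0 < ∫ g, w g ∂ν) {k : Γ} {a K : ℝ} (ha : 0 ≤ a) (hK : 0 ≤ K)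
    (x : EuclideanSpace ℂ (Fin N)) (hmove : a * ‖x‖ ≤ ‖act (π k) x - x‖)
    (hwk : ∀ g, Real.exp (-K) * w g ^ 2 ≤ w (g * k) * w (g * k⁻¹)) :
    ‖act (condMean ν π w) x‖ ≤ (1 - a ^ 2 * Real.exp (-K / 2) / 24) * ‖x‖ := by
  set M := condMean ν π w with hM
  have hwi : Integrable w ν := integrable_of_continuous_compact ν hwc
  have hwC : Continuous fun g => (w g : ℂ) := Complex.continuous_ofReal.comp hwc
  have hint : ∀ i j, Integrable (fun g => π g i j * (w g : ℂ)) ν := fun i j =>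
    integrable_of_continuous_compact ν ((hπc.matrix_elem i j).mul hwC)
  have hca := continuous_act_rep π hπc
  have hfw : Integrable (fun g => ‖act (π g) x - act M x‖ ^ 2 * w g) ν :=
    integrable_of_continuous_compact ν ((((hca x).sub continuous_const).norm.pow 2).mul hwc)
  have hi : Integrable (fun g => ⟪act M x, act (π g) x⟫_ℂ * (w g : ℂ)) ν :=
    integrable_of_continuous_compact ν ((continuous_const.inner (hca x)).mul hwC)
  have hvar := integral_norm_sub_sq_mul ν π hπu w hwi hint hZ.ne' x hi
  have hf0 : ∀ g, 0 ≤ ‖act (π g) x - act M x‖ := fun g => norm_nonneg _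
  have hmk : ‖act (π k⁻¹) x - x‖ = ‖act (π k) x - x‖ := by
    have : act (π k⁻¹) x - x = act (π k⁻¹) (x - act (π k) x) := by
      rw [act_sub, ← act_mul, ← map_mul, inv_mul_cancel, map_one, act_one]
    rw [this, norm_act_of_unitary (hπu _), norm_sub_rev]
  have hstep : ∀ k' : Γ, a * ‖x‖ ≤ ‖act (π k') x - x‖ →
      ∀ g, a * ‖x‖ ≤ ‖act (π g) x - act M x‖ + ‖act (π (g * k')) x - act M x‖ := by
    intro k' hk' g
    have e : act (π (g * k')) x - act M x - (act (π g) x - act M x) = act (π g) (act (π k') x - x) := by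
      rw [map_mul, act_mul, act_sub]; abel
    calc a * ‖x‖ ≤ ‖act (π k') x - x‖ := hk'
      _ = ‖act (π g) (act (π k') x - x)‖ := (norm_act_of_unitary (hπu g) _).symm
      _ = ‖act (π (g * k')) x - act M x - (act (π g) x - act M x)‖ := by rw [e]
      _ ≤ ‖act (π (g * k')) x - act M x‖ + ‖act (π g) x - act M x‖ := norm_sub_le _ _
      _ = _ := add_comm _ _
  have h1 := hstep k hmove
  have h2 := hstep k⁻¹ (hmk ▸ hmove)
  have hac := integral_sq_mul_ge ν hf0 (fun g => (hw0 g).le) hwi hfw k (δ := a * ‖x‖) (K := K)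
    (by positivity) hK h1 h2 hwk
  rw [hvar] at hac
  have hsq : ‖act M x‖ ^ 2 ≤ (1 - a ^ 2 * Real.exp (-K / 2) / 12) * ‖x‖ ^ 2 := by
    have h' : (∫ g, w g ∂ν) * ((a * ‖x‖) ^ 2 * Real.exp (-K / 2) / 12) ≤
        (∫ g, w g ∂ν) * (‖x‖ ^ 2 - ‖act M x‖ ^ 2) := by linarith
    have h'' := le_of_mul_le_mul_left h' hZ
    nlinarith
  have := norm_le_of_sq_le (by positivity) hsq
  convert this using 2
  ring

end AntiConcentration

/-! ## §B. The single-link kernels of the top run of the rectangle loop -/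

section Lattice

open Summit.QuantumFields.YangMills.Cruxes.IR.FixedMesh

variable {G : Type} [Group G] [TopologicalSpace G] [IsTopologicalGroup G] [CompactSpace G]
  [SecondCountableTopology G] [MeasurableSpace G] [BorelSpace G]
  {N : ℕ} (ρ : G →* Matrix (Fin N) (Fin N) ℂ)

/-! ### B.1 Plaquette geometry around one edge -/

omit [TopologicalSpace G] [IsTopologicalGroup G] [CompactSpace G] [SecondCountableTopology G]
  [MeasurableSpace G] [BorelSpace G] in
/-- **Slot decomposition.** Updating the configuration on one edge `e` of a plaquette `p` changes
exactly one of the four factors of the plaquette holonomy: as a function of the new value `g` the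
holonomy is `a g c` or `a g⁻¹ c` with `a, c` independent of `g`. -/
theorem exists_slot (p : ZdPlaquette 4) {e : ZdEdge 4} (he : e ∈ plaquetteEdges p) (η : LGConfig 4 G) :
    ∃ a c : G, (∀ g, plaquetteHolonomyZd (Function.update η e g) p.1 p.2.1.1 p.2.1.2 = a * g * c) ∨
      (∀ g, plaquetteHolonomyZd (Function.update η e g) p.1 p.2.1.1 p.2.1.2 = a * g⁻¹ * c) := by
  obtain ⟨x, ⟨⟨i, j⟩, hij⟩⟩ := p
  simp only at hij
  have hij' : i ≠ j := ne_of_lt hij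
  -- the four edges and their distinctness
  have hxi : x + Pi.single i (1 : ℤ) ≠ x := by
    intro h; have := congrArg (fun y => y i) h; simp at this
  have hxj : x + Pi.single j (1 : ℤ) ≠ x := by
    intro h; have := congrArg (fun y => y j) h; simp at this
  have n12 : ((x, i) : ZdEdge 4) ≠ (x + Pi.single i 1, j) := fun h => hij' (congrArg Prod.snd h)
  have n13 : ((x, i) : ZdEdge 4) ≠ (x + Pi.single j 1, i) := fun h => hxj (congrArg Prod.fst h).symm
  have n14 : ((x, i) : ZdEdge 4) ≠ (x, j) := fun h => hij' (congrArg Prod.snd h)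
  have n23 : ((x + Pi.single i 1, j) : ZdEdge 4) ≠ (x + Pi.single j 1, i) := fun h => hij' (congrArg Prod.snd h).symm
  have n24 : ((x + Pi.single i 1, j) : ZdEdge 4) ≠ (x, j) := fun h => hxi (congrArg Prod.fst h)
  have n34 : ((x + Pi.single j 1, i) : ZdEdge 4) ≠ (x, j) := fun h => hij' (congrArg Prod.snd h)
  simp only [plaquetteEdges, Finset.mem_insert, Finset.mem_singleton] at he
  simp only [plaquetteHolonomyZd]
  rcases he with rfl | rfl | rfl | rfl
  · refine ⟨1, η (x + Pi.single i 1, j) * (η (x + Pi.single j 1, i))⁻¹ * (η (x, j))⁻¹, Or.inl fun g => ?_⟩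
    rw [Function.update_self, Function.update_of_ne n12.symm, Function.update_of_ne n13.symm,
      Function.update_of_ne n14.symm]
    group
  · refine ⟨η (x, i), (η (x + Pi.single j 1, i))⁻¹ * (η (x, j))⁻¹, Or.inl fun g => ?_⟩
    rw [Function.update_self, Function.update_of_ne n12, Function.update_of_ne n23.symm,
      Function.update_of_ne n24.symm]
    group
  · refine ⟨η (x, i) * η (x + Pi.single i 1, j), (η (x, j))⁻¹, Or.inr fun g => ?_⟩
    rw [Function.update_self, Function.update_of_ne n13, Function.update_of_ne n23,
      Function.update_of_ne n34.symm]
  · refine ⟨η (x, i) * η (x + Pi.single i 1, j) * (η (x + Pi.single j 1, i))⁻¹, 1, Or.inr fun g => ?_⟩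
    rw [Function.update_self, Function.update_of_ne n14, Function.update_of_ne n24,
      Function.update_of_ne n34]
    group

/-- The number of plaquettes of `ℤ⁴` through one edge is at most `30` (in fact `6`). -/
theorem card_plaquettesTouching_singleton_le (e : ZdEdge 4) :
    (plaquettesTouching ({e} : Finset (ZdEdge 4))).card ≤ 30 := by
  unfold plaquettesTouching
  refine (Finset.card_filter_le _ _).trans ?_
  rw [Finset.card_product]
  have h1 : (({e} : Finset (ZdEdge 4)).image Prod.fst ∪
      ((({e} : Finset (ZdEdge 4)) ×ˢ (Finset.univ : Finset (Fin 4))).image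
        fun ej => ej.1.1 - Pi.single ej.2 1)).card ≤ 5 := by
    refine (Finset.card_union_le _ _).trans ?_
    have a : (({e} : Finset (ZdEdge 4)).image Prod.fst).card ≤ 1 :=
      Finset.card_image_le.trans (by simp)
    have b : ((({e} : Finset (ZdEdge 4)) ×ˢ (Finset.univ : Finset (Fin 4))).image
        fun ej => ej.1.1 - Pi.single ej.2 1).card ≤ 4 :=
      Finset.card_image_le.trans (by simp)
    omega
  have h2 : (Finset.univ : Finset {q : Fin 4 × Fin 4 // q.1 < q.2}).card = 6 := by
    rw [Finset.card_univ, Fintype.card_subtype]; decide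
  rw [h2]
  omega

omit [TopologicalSpace G] [IsTopologicalGroup G] [CompactSpace G] [SecondCountableTopology G]
  [MeasurableSpace G] [BorelSpace G] in
/-- **Second difference of one plaquette term.** If `‖ρ(k)v + ρ(k⁻¹)v − 2v‖ ≤ κ‖v‖` for all `v`,
then for every plaquette `p ∋ e`: `|W_p(g k) + W_p(g k⁻¹) − 2 W_p(g)| ≤ N κ`, where
`W_p(g') = Re tr ρ(U_p(η[e ↦ g']))`. -/
theorem abs_second_diff_plaquetteObs_le (hρu : ∀ g, ρ g ∈ Matrix.unitaryGroup (Fin N) ℂ)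
    {k : G} {κ : ℝ} (hκ : 0 ≤ κ)
    (hk : ∀ v : EuclideanSpace ℂ (Fin N), ‖act (ρ k) v + act (ρ k⁻¹) v - (2 : ℂ) • v‖ ≤ κ * ‖v‖)
    (p : ZdPlaquette 4) {e : ZdEdge 4} (he : e ∈ plaquetteEdges p) (η : LGConfig 4 G) (g : G) :
    |plaquetteObs ρ p.1 p.2.1.1 p.2.1.2 (Function.update η e (g * k)) +
        plaquetteObs ρ p.1 p.2.1.1 p.2.1.2 (Function.update η e (g * k⁻¹)) -
        2 * plaquetteObs ρ p.1 p.2.1.1 p.2.1.2 (Function.update η e g)| ≤ N * κ := by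
  set D : Matrix (Fin N) (Fin N) ℂ := ρ k + ρ k⁻¹ - (2 : ℂ) • 1 with hD
  have hDc : IsContr D κ := fun v => by
    have : act D v = act (ρ k) v + act (ρ k⁻¹) v - (2 : ℂ) • v := by
      rw [hD, sub_act, add_act, smul_act, act_one]
    rw [this]; exact hk v
  obtain ⟨a, c, hslot | hslot⟩ := exists_slot p he η
  · -- forward slot: `ρ(a g k c) + ρ(a g k⁻¹ c) − 2ρ(a g c) = ρ(a)ρ(g)·D·ρ(c)`, then a cyclic move
    simp only [plaquetteObs, hslot]
    have hm : ρ (a * (g * k) * c) + ρ (a * (g * k⁻¹) * c) - (2 : ℂ) • ρ (a * g * c) =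
        ρ a * ρ g * D * ρ c := by
      simp only [map_mul, hD]; noncomm_ring
    have hcyc : (ρ a * ρ g * D * ρ c).trace = ((ρ c * ρ a * ρ g) * D).trace := by
      rw [Matrix.trace_mul_comm, ← Matrix.mul_assoc, ← Matrix.mul_assoc]
    have h2 := congrArg (fun M : Matrix (Fin N) (Fin N) ℂ => M.trace.re) hm
    simp only [two_smul, Matrix.trace_sub, Matrix.trace_add, Complex.sub_re, Complex.add_re] at h2
    rw [two_mul, h2, hcyc]
    have hU : ρ c * ρ a * ρ g ∈ Matrix.unitaryGroup (Fin N) ℂ := by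
      rw [← map_mul, ← map_mul]; exact hρu _
    have := abs_re_trace_le_of_isContr ((isContr_of_unitary hU).mul hDc zero_le_one)
    simpa using this
  · simp only [plaquetteObs, hslot]
    have hm : ρ (a * (g * k)⁻¹ * c) + ρ (a * (g * k⁻¹)⁻¹ * c) - (2 : ℂ) • ρ (a * g⁻¹ * c) =
        ρ a * D * ρ g⁻¹ * ρ c := by
      simp only [mul_inv_rev, inv_inv, map_mul, hD]; noncomm_ring
    have hcyc : (ρ a * D * ρ g⁻¹ * ρ c).trace = (D * (ρ g⁻¹ * ρ c * ρ a)).trace := by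
      have := Matrix.trace_mul_comm (ρ a) (D * ρ g⁻¹ * ρ c)
      simp only [Matrix.mul_assoc] at this ⊢
      exact this
    have h2 := congrArg (fun M : Matrix (Fin N) (Fin N) ℂ => M.trace.re) hm
    simp only [two_smul, Matrix.trace_sub, Matrix.trace_add, Complex.sub_re, Complex.add_re] at h2
    rw [two_mul, h2, hcyc]
    have hU : ρ g⁻¹ * ρ c * ρ a ∈ Matrix.unitaryGroup (Fin N) ℂ := by
      rw [← map_mul, ← map_mul]; exact hρu _
    have := abs_re_trace_le_of_isContr (hDc.mul (isContr_of_unitary hU) hκ)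
    simpa using this

omit [TopologicalSpace G] [IsTopologicalGroup G] [CompactSpace G] [SecondCountableTopology G]
  [MeasurableSpace G] [BorelSpace G] in
/-- **Second difference of the one-edge boundary action**: `|S(gk) + S(gk⁻¹) − 2S(g)| ≤ 30 N κ`. -/
theorem abs_second_diff_action_le (hρu : ∀ g, ρ g ∈ Matrix.unitaryGroup (Fin N) ℂ)
    {k : G} {κ : ℝ} (hκ : 0 ≤ κ)
    (hk : ∀ v : EuclideanSpace ℂ (Fin N), ‖act (ρ k) v + act (ρ k⁻¹) v - (2 : ℂ) • v‖ ≤ κ * ‖v‖)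
    (e : ZdEdge 4) (η : LGConfig 4 G) (g : G) :
    |wilsonBoundaryAction ρ {e} (Function.update η e (g * k)) +
        wilsonBoundaryAction ρ {e} (Function.update η e (g * k⁻¹)) -
        2 * wilsonBoundaryAction ρ {e} (Function.update η e g)| ≤ 30 * N * κ := by
  unfold wilsonBoundaryAction
  rw [Finset.mul_sum, ← Finset.sum_add_distrib, ← Finset.sum_sub_distrib]
  refine (Finset.abs_sum_le_sum_abs _ _).trans ?_
  have hterm : ∀ p ∈ plaquettesTouching ({e} : Finset (ZdEdge 4)),
      |(N : ℝ) - plaquetteObs ρ p.1 p.2.1.1 p.2.1.2 (Function.update η e (g * k)) +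
          ((N : ℝ) - plaquetteObs ρ p.1 p.2.1.1 p.2.1.2 (Function.update η e (g * k⁻¹))) -
          2 * ((N : ℝ) - plaquetteObs ρ p.1 p.2.1.1 p.2.1.2 (Function.update η e g))| ≤ N * κ := by
    intro p hp
    have he : e ∈ plaquetteEdges p := by
      obtain ⟨e', he'⟩ := mem_plaquettesTouching_iff.1 hp
      rw [Finset.mem_inter, Finset.mem_singleton] at he'
      exact he'.2 ▸ he'.1
    have := abs_second_diff_plaquetteObs_le ρ hρu hκ hk p he η g
    rw [← abs_neg]
    convert this using 2; ring
  refine (Finset.sum_le_sum hterm).trans ?_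
  rw [Finset.sum_const, nsmul_eq_mul]
  have := card_plaquettesTouching_singleton_le e
  have hNκ : 0 ≤ (N : ℝ) * κ := by positivity
  calc ((plaquettesTouching ({e} : Finset (ZdEdge 4))).card : ℝ) * (N * κ) ≤ 30 * (N * κ) :=
        mul_le_mul_of_nonneg_right (by exact_mod_cast this) hNκ
    _ = 30 * N * κ := by ring

/-! ### B.2 The single-link fibre, its tilted Haar law, and the contraction of its mean -/

/-- The distinguished point of the singleton index type `↥{e}`. -/
def theEdge (e : ZdEdge 4) : ↥({e} : Finset (ZdEdge 4)) := ⟨e, Finset.mem_singleton_self e⟩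

omit [TopologicalSpace G] [IsTopologicalGroup G] [CompactSpace G] [SecondCountableTopology G]
  [MeasurableSpace G] [BorelSpace G] in
theorem eq_theEdge {e : ZdEdge 4} (i : ↥({e} : Finset (ZdEdge 4))) : i = theEdge e :=
  Subtype.ext (Finset.mem_singleton.1 i.2)

omit [Group G] [TopologicalSpace G] [IsTopologicalGroup G] [CompactSpace G] [SecondCountableTopology G]
  [MeasurableSpace G] [BorelSpace G] in
/-- Gluing on a single edge is a one-point update. -/
theorem glueWith_singleton (e : ZdEdge 4) (ζ : ↥({e} : Finset (ZdEdge 4)) → G) (η : LGConfig 4 G) :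
    glueWith {e} ζ η = Function.update η e (ζ (theEdge e)) := by
  funext e'
  by_cases h : e' = e
  · subst h
    rw [glueWith_apply_mem _ _ _ (Finset.mem_singleton_self _), Function.update_self]; rfl
  · rw [glueWith_apply_not_mem _ _ _ (by simpa using h), Function.update_of_ne h]

/-- The representation read on the single link: `ζ ↦ ρ(ζ_e)`. -/
noncomputable def linkRep (e : ZdEdge 4) : (↥({e} : Finset (ZdEdge 4)) → G) →* Matrix (Fin N) (Fin N) ℂ :=
  ρ.comp (Pi.evalMonoidHom (fun _ => G) (theEdge e))

omit [TopologicalSpace G] [IsTopologicalGroup G] [CompactSpace G] [SecondCountableTopology G]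
  [MeasurableSpace G] [BorelSpace G] in
@[simp] theorem linkRep_apply (e : ZdEdge 4) (ζ : ↥({e} : Finset (ZdEdge 4)) → G) :
    linkRep ρ e ζ = ρ (ζ (theEdge e)) := rfl

/-- The product Haar law on the single-link fibre. -/
noncomputable abbrev linkPi (e : ZdEdge 4) : Measure (↥({e} : Finset (ZdEdge 4)) → G) :=
  Measure.pi fun _ => haarProbability G

/-- The single-link DLR weight `ζ ↦ exp(−β S_{e}(ζ η_{eᶜ}))`. -/
noncomputable def linkW (β : ℝ) (e : ZdEdge 4) (η : LGConfig 4 G) (ζ : ↥({e} : Finset (ZdEdge 4)) → G) : ℝ :=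
  Real.exp (-β * wilsonBoundaryAction ρ {e} (glueWith {e} ζ η))

/-- The single-link conditional mean of `ρ`: `M_e(η) = E_{γ_{e}(·|η)} ρ(U_e)` (entrywise). -/
noncomputable def linkMean (β : ℝ) (e : ZdEdge 4) (η : LGConfig 4 G) : Matrix (Fin N) (Fin N) ℂ :=
  condMean (linkPi e) (linkRep ρ e) (linkW ρ β e η)

omit [IsTopologicalGroup G] [CompactSpace G] [SecondCountableTopology G] [MeasurableSpace G]
  [BorelSpace G] in
theorem continuous_linkRep (hρ : Continuous ρ) (e : ZdEdge 4) :
    Continuous (linkRep ρ e : (↥({e} : Finset (ZdEdge 4)) → G) → Matrix (Fin N) (Fin N) ℂ) :=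
  hρ.comp (continuous_apply _)

omit [TopologicalSpace G] [IsTopologicalGroup G] [CompactSpace G] [SecondCountableTopology G]
  [MeasurableSpace G] [BorelSpace G] in
theorem linkRep_unitary (hρu : ∀ g, ρ g ∈ Matrix.unitaryGroup (Fin N) ℂ) (e : ZdEdge 4)
    (ζ : ↥({e} : Finset (ZdEdge 4)) → G) : linkRep ρ e ζ ∈ Matrix.unitaryGroup (Fin N) ℂ :=
  hρu _

omit [CompactSpace G] [SecondCountableTopology G] [MeasurableSpace G] [BorelSpace G] in
theorem continuous_linkW (hρ : Continuous ρ) (β : ℝ) (e : ZdEdge 4) (η : LGConfig 4 G) :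
    Continuous (linkW ρ β e η) :=
  Real.continuous_exp.comp (continuous_const.mul ((continuous_wilsonBoundaryAction ρ hρ _).comp
    ((continuous_glueWith_prod _).comp (Continuous.prodMk_right η))))

omit [TopologicalSpace G] [IsTopologicalGroup G] [CompactSpace G] [SecondCountableTopology G]
  [MeasurableSpace G] [BorelSpace G] in
theorem linkW_pos (β : ℝ) (e : ZdEdge 4) (η : LGConfig 4 G) (ζ : ↥({e} : Finset (ZdEdge 4)) → G) :
    0 < linkW ρ β e η ζ :=
  Real.exp_pos _

theorem integral_linkW_pos (hρ : Continuous ρ) (β : ℝ) (e : ZdEdge 4) (η : LGConfig 4 G) :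
    0 < ∫ ζ, linkW ρ β e η ζ ∂linkPi e :=
  normaliser_pos ρ hρ β {e} η

omit [TopologicalSpace G] [IsTopologicalGroup G] [CompactSpace G] [SecondCountableTopology G]
  [MeasurableSpace G] [BorelSpace G] in
/-- **Log-quasi-invariance of the single-link weight**: `e^{−30Nβκ} w(ζ)² ≤ w(ζk) w(ζk⁻¹)`. -/
theorem linkW_second_diff (hρu : ∀ g, ρ g ∈ Matrix.unitaryGroup (Fin N) ℂ) {β : ℝ} (hβ : 0 ≤ β)
    {k : G} {κ : ℝ} (hκ : 0 ≤ κ)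
    (hk : ∀ v : EuclideanSpace ℂ (Fin N), ‖act (ρ k) v + act (ρ k⁻¹) v - (2 : ℂ) • v‖ ≤ κ * ‖v‖)
    (e : ZdEdge 4) (η : LGConfig 4 G) (ζ : ↥({e} : Finset (ZdEdge 4)) → G) :
    Real.exp (-(30 * N * (β * κ))) * linkW ρ β e η ζ ^ 2 ≤
      linkW ρ β e η (ζ * fun _ => k) * linkW ρ β e η (ζ * (fun _ => k)⁻¹) := by
  simp only [linkW, glueWith_singleton, Pi.mul_apply, Pi.inv_apply]
  set g := ζ (theEdge e)
  set S := fun g' : G => wilsonBoundaryAction ρ {e} (Function.update η e g')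
  have h := abs_second_diff_action_le ρ hρu hκ hk e η g
  have h1 : S (g * k) + S (g * k⁻¹) ≤ 2 * S g + 30 * N * κ := by
    have := (abs_le.1 h).2; simp only [S]; linarith
  rw [sq, ← Real.exp_add, ← Real.exp_add, ← Real.exp_add]
  refine Real.exp_le_exp.2 ?_
  have := mul_le_mul_of_nonneg_left h1 hβ
  simp only [S] at this
  nlinarith

omit [TopologicalSpace G] [IsTopologicalGroup G] [CompactSpace G] [SecondCountableTopology G]
  [MeasurableSpace G] [BorelSpace G] in
/-- **Lie-free mobility hypothesis on `ρ`.**  For every vector `x` and every scale `t ∈ (0,1]`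
there is a group element `k` that MOVES `x` by `≥ a₀ t ‖x‖` while `ρ(k) + ρ(k⁻¹) − 2` is
`K₀ t²`-small (a "second-order" element at scale `t`).  Holds for `U(1)` (`a₀ = 2`, `K₀ = π²`),
for the fundamental of `SU(2)`, and for every continuous unitary `ρ` of a compact connected Lie
group whose restriction has no invariant vector (one-parameter subgroups); FAILS for finite `G`
(as it must: finite gauge groups freeze up to `b ~ e^{cβ}`). -/
def MobilePairs (a₀ K₀ : ℝ) : Prop :=
  0 < a₀ ∧ 0 ≤ K₀ ∧ ∀ x : EuclideanSpace ℂ (Fin N), ∀ t : ℝ, 0 < t → t ≤ 1 →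
    ∃ k : G, a₀ * t * ‖x‖ ≤ ‖act (ρ k) x - x‖ ∧
      ∀ v : EuclideanSpace ℂ (Fin N), ‖act (ρ k) v + act (ρ k⁻¹) v - (2 : ℂ) • v‖ ≤ K₀ * t ^ 2 * ‖v‖

/-- The `β`-free anti-concentration constant `c(ρ) = a₀² e^{−15 N K₀} / 12 ∧ 1`. -/
noncomputable def ceilC (N : ℕ) (a₀ K₀ : ℝ) : ℝ := min (a₀ ^ 2 * Real.exp (-(30 * N * K₀) / 2) / 12) 1

theorem ceilC_pos (N : ℕ) {a₀ : ℝ} (ha : 0 < a₀) (K₀ : ℝ) : 0 < ceilC N a₀ K₀ :=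
  lt_min (by positivity) one_pos

theorem ceilC_le_one (N : ℕ) (a₀ K₀ : ℝ) : ceilC N a₀ K₀ ≤ 1 := min_le_right _ _

/-- **Contraction of the single-link conditional mean**: under `MobilePairs ρ a₀ K₀` and `β ≥ 1`,
`‖M_e(η) x‖ ≤ (1 − c/(2β)) ‖x‖` for every edge `e`, boundary condition `η` and vector `x`. -/
theorem linkMean_isContr (hρ : Continuous ρ) (hρu : ∀ g, ρ g ∈ Matrix.unitaryGroup (Fin N) ℂ)
    {a₀ K₀ : ℝ} (hmob : MobilePairs ρ a₀ K₀) {β : ℝ} (hβ : 1 ≤ β) (e : ZdEdge 4) (η : LGConfig 4 G) :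
    IsContr (linkMean ρ β e η) (1 - ceilC N a₀ K₀ / (2 * β)) := by
  intro x
  have hβ0 : 0 < β := by linarith
  set t : ℝ := (Real.sqrt β)⁻¹ with ht
  have hsq : 0 < Real.sqrt β := Real.sqrt_pos.2 hβ0
  have ht0 : 0 < t := by rw [ht]; positivity
  have ht2 : t ^ 2 = β⁻¹ := by rw [ht, inv_pow, Real.sq_sqrt hβ0.le]
  have ht1 : t ≤ 1 := by
    rw [ht]; refine inv_le_one_of_one_le₀ ?_
    rw [show (1 : ℝ) = Real.sqrt 1 by simp]; exact Real.sqrt_le_sqrt hβ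
  obtain ⟨ha₀, hK₀, hmob'⟩ := hmob
  obtain ⟨k, hmove, hk⟩ := hmob' x t ht0 ht1
  have hκ : 0 ≤ K₀ * t ^ 2 := by positivity
  have hmain := norm_act_condMean_le (linkPi e) (linkRep ρ e) (continuous_linkRep ρ hρ e)
    (linkRep_unitary ρ hρu e) (continuous_linkW ρ hρ β e η) (linkW_pos ρ β e η)
    (integral_linkW_pos ρ hρ β e η) (k := fun _ => k) (a := a₀ * t) (K := 30 * N * K₀)
    (by positivity) (by positivity) x (by simpa using hmove) (fun ζ => by
      have := linkW_second_diff ρ hρu hβ0.le hκ hk e η ζ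
      have e1 : β * (K₀ * t ^ 2) = K₀ := by rw [ht2]; field_simp
      rwa [e1] at this)
  refine hmain.trans (mul_le_mul_of_nonneg_right ?_ (norm_nonneg _))
  have hc : ceilC N a₀ K₀ / (2 * β) ≤ (a₀ * t) ^ 2 * Real.exp (-(30 * N * K₀) / 2) / 24 := by
    rw [mul_pow, ht2]
    have := min_le_left (a₀ ^ 2 * Real.exp (-(30 * N * K₀) / 2) / 12) 1
    unfold ceilC
    rw [div_le_iff₀ (by positivity)]
    calc min (a₀ ^ 2 * Real.exp (-(30 * ↑N * K₀) / 2) / 12) 1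
        ≤ a₀ ^ 2 * Real.exp (-(30 * ↑N * K₀) / 2) / 12 := this
      _ = a₀ ^ 2 * β⁻¹ * Real.exp (-(30 * ↑N * K₀) / 2) / 24 * (2 * β) := by field_simp; ring
  linarith

/-! ### B.3 The top run of the staple: resampling one link at a time -/

/-- The `s`-th link of the top run of the staple: `((b+1, s, 0, 0), 1)`. -/
def topLink (b s : ℕ) : ZdEdge 4 := (site2 ((b : ℤ) + 1) s, (1 : Fin 4))

omit [Group G] [TopologicalSpace G] [IsTopologicalGroup G] [CompactSpace G] [SecondCountableTopology G]
  [MeasurableSpace G] [BorelSpace G] in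
@[simp] theorem topLink_fst (b s : ℕ) : (topLink b s).1 = site2 ((b : ℤ) + 1) s := rfl

omit [Group G] [TopologicalSpace G] [IsTopologicalGroup G] [CompactSpace G] [SecondCountableTopology G]
  [MeasurableSpace G] [BorelSpace G] in
@[simp] theorem topLink_snd (b s : ℕ) : (topLink b s).2 = 1 := rfl

omit [Group G] [TopologicalSpace G] [IsTopologicalGroup G] [CompactSpace G] [SecondCountableTopology G]
  [MeasurableSpace G] [BorelSpace G] in
theorem topLink_injective (b : ℕ) : Function.Injective (topLink b) := by
  intro s s' h
  have := congrArg (fun e : ZdEdge 4 => e.1 1) h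
  simpa [topLink] using this

/-- The staple minus its top run (down run, bottom run, closing link). -/
def rest (b m : ℕ) (U : LGConfig 4 G) : G :=
  (((List.range (b + 1)).reverse).map fun t : ℕ => (U (site2 t m, 0))⁻¹).prod *
    ((((List.range m).reverse).map fun s : ℕ => (U (site2 0 s, 1))⁻¹).prod * U (site2 0 0, 0))

omit [TopologicalSpace G] [IsTopologicalGroup G] [CompactSpace G] [SecondCountableTopology G]
  [MeasurableSpace G] [BorelSpace G] in
theorem staple_eq_top_mul_rest (b m : ℕ) (U : LGConfig 4 G) :
    staple b m U = ((List.range m).map fun s => U (topLink b s)).prod * rest b m U := rfl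

/-- Edges read by `rest`. -/
def restEdges (b m : ℕ) : Finset (ZdEdge 4) :=
  ((Finset.range (b + 1)).image fun t : ℕ => (site2 t m, (0 : Fin 4))) ∪
    ((Finset.range m).image fun s : ℕ => (site2 0 s, (1 : Fin 4))) ∪ {(site2 0 0, (0 : Fin 4))}

omit [TopologicalSpace G] [IsTopologicalGroup G] [CompactSpace G] [SecondCountableTopology G]
  [MeasurableSpace G] [BorelSpace G] in
theorem rest_congr {b m : ℕ} {U U' : LGConfig 4 G} (h : ∀ e ∈ restEdges b m, U e = U' e) :
    rest b m U = rest b m U' := by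
  unfold rest
  have hdown : (((List.range (b + 1)).reverse).map fun t : ℕ => (U (site2 t m, 0))⁻¹) =
      ((List.range (b + 1)).reverse).map fun t : ℕ => (U' (site2 t m, 0))⁻¹ := by
    refine List.map_congr_left fun t ht => ?_
    rw [h _ ?_]
    simp only [restEdges, Finset.mem_union, Finset.mem_image, Finset.mem_range, Finset.mem_singleton]
    exact Or.inl (Or.inl ⟨t, by simpa using ht, rfl⟩)
  have hbot : (((List.range m).reverse).map fun s : ℕ => (U (site2 0 s, 1))⁻¹) =
      ((List.range m).reverse).map fun s : ℕ => (U' (site2 0 s, 1))⁻¹ := by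
    refine List.map_congr_left fun s hs => ?_
    rw [h _ ?_]
    simp only [restEdges, Finset.mem_union, Finset.mem_image, Finset.mem_range, Finset.mem_singleton]
    exact Or.inl (Or.inr ⟨s, by simpa using hs, rfl⟩)
  have hclose : U (site2 0 0, 0) = U' (site2 0 0, 0) := h _ (by simp [restEdges])
  rw [hdown, hbot, hclose]

omit [Group G] [TopologicalSpace G] [IsTopologicalGroup G] [CompactSpace G] [SecondCountableTopology G]
  [MeasurableSpace G] [BorelSpace G] in
theorem topLink_not_mem_colEdges (b s : ℕ) : topLink b s ∉ FixedMesh.colEdges b := by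
  intro h
  unfold FixedMesh.colEdges at h
  rcases Finset.mem_union.1 h with h | h
  · have := congrArg Prod.snd (Finset.mem_singleton.1 h)
    simp [topLink] at this
  · obtain ⟨i, _, hi⟩ := Finset.mem_image.1 h
    have := congrArg Prod.snd hi
    simp [topLink] at this

omit [Group G] [TopologicalSpace G] [IsTopologicalGroup G] [CompactSpace G] [SecondCountableTopology G]
  [MeasurableSpace G] [BorelSpace G] in
theorem topLink_not_mem_restEdges {b m s : ℕ} : topLink b s ∉ restEdges b m := by
  intro h
  unfold restEdges at h
  rcases Finset.mem_union.1 h with h | h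
  · rcases Finset.mem_union.1 h with h | h
    · obtain ⟨t, _, ht⟩ := Finset.mem_image.1 h
      have := congrArg Prod.snd ht
      simp [topLink] at this
    · obtain ⟨s', _, hs'⟩ := Finset.mem_image.1 h
      have := congrArg (fun e : ZdEdge 4 => e.1 0) hs'
      simp [topLink] at this
      omega
  · have := congrArg Prod.snd (Finset.mem_singleton.1 h)
    simp [topLink] at this

omit [Group G] [TopologicalSpace G] [IsTopologicalGroup G] [CompactSpace G] [SecondCountableTopology G]
  [MeasurableSpace G] [BorelSpace G] in
/-- The base point of an edge of a plaquette has the same coordinate ALONG THE EDGE as the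
plaquette's base point; in particular two parallel edges of one plaquette share that coordinate. -/
theorem base_coord_of_mem_plaquetteEdges {p : ZdPlaquette 4} {e : ZdEdge 4} (he : e ∈ plaquetteEdges p) :
    e.1 e.2 = p.1 e.2 := by
  obtain ⟨x, ⟨⟨i, j⟩, hij⟩⟩ := p
  simp only at hij
  simp only [plaquetteEdges, Finset.mem_insert, Finset.mem_singleton] at he
  rcases he with rfl | rfl | rfl | rfl
  · rfl
  · simp [hij.ne']
  · simp [hij.ne]
  · rfl

omit [Group G] [TopologicalSpace G] [IsTopologicalGroup G] [CompactSpace G] [SecondCountableTopology G]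
  [MeasurableSpace G] [BorelSpace G] in
/-- Distinct links of the top run are never edges of a common plaquette. -/
theorem topLink_not_mem_collar {b s s' : ℕ} (h : s ≠ s') :
    topLink b s ∉ (plaquettesTouching ({topLink b s'} : Finset (ZdEdge 4))).biUnion plaquetteEdges := by
  intro hmem
  obtain ⟨p, hp, he⟩ := Finset.mem_biUnion.1 hmem
  obtain ⟨e', he'⟩ := mem_plaquettesTouching_iff.1 hp
  rw [Finset.mem_inter, Finset.mem_singleton] at he'
  obtain ⟨he'p, rfl⟩ := he'
  have h1 := base_coord_of_mem_plaquetteEdges he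
  have h2 := base_coord_of_mem_plaquetteEdges he'p
  simp only [topLink_fst, topLink_snd, site2_one] at h1 h2
  exact h (by exact_mod_cast h1.trans h2.symm)

omit [Group G] [TopologicalSpace G] [IsTopologicalGroup G] [CompactSpace G] [SecondCountableTopology G]
  [MeasurableSpace G] [BorelSpace G] in
/-- A top link and its collar sit inside the box of half-width `(2n+2)b+1` (`b ≥ 1`). -/
theorem topLink_collar_mem_box {b n s : ℕ} (hb : 1 ≤ b) (hs : s < (2 * n + 1) * b) :
    ∀ e ∈ ({topLink b s} : Finset (ZdEdge 4)) ∪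
        (plaquettesTouching ({topLink b s} : Finset (ZdEdge 4))).biUnion plaquetteEdges,
      e.1 ∈ box 4 ((2 * n + 2) * b + 1) := by
  have hs' : (s : ℤ) < (2 * n + 1) * b := by exact_mod_cast hs
  have hb' : (1 : ℤ) ≤ b := by exact_mod_cast hb
  have hn : (0 : ℤ) ≤ n := Int.natCast_nonneg n
  have hnb : (0 : ℤ) ≤ (n : ℤ) * b := by positivity
  have key : ∀ e : ZdEdge 4, (∀ k, (topLink b s).1 k - 1 ≤ e.1 k ∧ e.1 k ≤ (topLink b s).1 k + 1) →
      e.1 ∈ box 4 ((2 * n + 2) * b + 1) := by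
    intro e he
    rw [mem_box]
    intro k
    push_cast
    have h0 := he k
    simp only [topLink_fst, site2] at h0
    split_ifs at h0 <;> constructor <;> nlinarith
  intro e he
  rcases Finset.mem_union.1 he with he | he
  · rw [Finset.mem_singleton] at he
    subst he
    exact key _ fun k => ⟨by omega, by omega⟩
  · obtain ⟨e', he', hn'⟩ := exists_near_of_mem_collar he
    rw [Finset.mem_singleton] at he'
    subst he'
    exact key _ hn'

omit [TopologicalSpace G] [IsTopologicalGroup G] [CompactSpace G] [SecondCountableTopology G]
  [MeasurableSpace G] [BorelSpace G] in
/-- The single-link weight at `e` does not see the configuration at `e` nor outside the collar. -/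
theorem linkW_congr (β : ℝ) {e : ZdEdge 4} {η₁ η₂ : LGConfig 4 G}
    (h : ∀ x ∈ (plaquettesTouching ({e} : Finset (ZdEdge 4))).biUnion plaquetteEdges, x ≠ e →
      η₁ x = η₂ x) : linkW ρ β e η₁ = linkW ρ β e η₂ := by
  funext ζ
  simp only [linkW]
  refine congrArg (fun t => Real.exp (-β * t))
    (isCylinder_wilsonBoundaryAction_holds (G := G) ρ {e} fun x hx => ?_)
  by_cases hxe : x = e
  · subst hxe
    rw [glueWith_apply_mem _ _ _ (Finset.mem_singleton_self _),
      glueWith_apply_mem _ _ _ (Finset.mem_singleton_self _)]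
  · rw [glueWith_apply_not_mem _ _ _ (by simpa using hxe),
      glueWith_apply_not_mem _ _ _ (by simpa using hxe)]
    exact h x (Finset.mem_coe.1 hx) hxe

omit [SecondCountableTopology G] in
theorem linkMean_congr (β : ℝ) {e : ZdEdge 4} {η₁ η₂ : LGConfig 4 G}
    (h : ∀ x ∈ (plaquettesTouching ({e} : Finset (ZdEdge 4))).biUnion plaquetteEdges, x ≠ e →
      η₁ x = η₂ x) : linkMean ρ β e η₁ = linkMean ρ β e η₂ := by
  unfold linkMean
  rw [linkW_congr ρ β h]

omit [SecondCountableTopology G] in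
theorem linkMean_update_topLink {b s s' : ℕ} (h : s ≠ s') (β : ℝ) (η : LGConfig 4 G) (g : G) :
    linkMean ρ β (topLink b s') (Function.update η (topLink b s) g) = linkMean ρ β (topLink b s') η :=
  linkMean_congr ρ β fun x hx _ =>
    Function.update_of_ne (by rintro rfl; exact topLink_not_mem_collar h hx) _ _

omit [TopologicalSpace G] [IsTopologicalGroup G] [CompactSpace G] [SecondCountableTopology G]
  [MeasurableSpace G] [BorelSpace G] in
theorem col_update_topLink (b s : ℕ) (η : LGConfig 4 G) (g : G) :
    col b (Function.update η (topLink b s) g) = col b η :=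
  col_congr fun e he => Function.update_of_ne (by rintro rfl; exact topLink_not_mem_colEdges b s he) _ _

omit [TopologicalSpace G] [IsTopologicalGroup G] [CompactSpace G] [SecondCountableTopology G]
  [MeasurableSpace G] [BorelSpace G] in
theorem rest_update_topLink (b m s : ℕ) (η : LGConfig 4 G) (g : G) :
    rest b m (Function.update η (topLink b s) g) = rest b m η :=
  rest_congr fun e he => Function.update_of_ne (by rintro rfl; exact topLink_not_mem_restEdges he) _ _

/-- Splitting a `List.range` product at position `s`. -/
theorem prod_map_range_split {M : Type*} [Monoid M] (f : ℕ → M) {m s : ℕ} (hs : s < m) :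
    ((List.range m).map f).prod =
      ((List.range s).map f).prod * (f s * ((List.range (m - (s + 1))).map fun i => f (s + 1 + i)).prod) := by
  obtain ⟨r, rfl⟩ : ∃ r, m = s + 1 + r := ⟨m - (s + 1), by omega⟩
  rw [List.range_add, List.range_succ, List.map_append, List.map_append, List.prod_append,
    List.prod_append, List.map_map, Nat.add_sub_cancel_left]
  simp only [List.map_cons, List.map_nil, List.prod_cons, List.prod_nil, mul_one, mul_assoc]
  rfl

/-- The `s'`-th factor of the top run after `s` links have been resampled: the single-link mean for
`s' < s`, the bare link variable for `s' ≥ s`. -/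
noncomputable def topFactor (β : ℝ) (b s : ℕ) (η : LGConfig 4 G) (s' : ℕ) : Matrix (Fin N) (Fin N) ℂ :=
  if s' < s then linkMean ρ β (topLink b s') η else ρ (η (topLink b s'))

/-- CLOSED FORM after `s` single-link resamplings:
`F_s(η) = Re tr(ρ(col) · ∏_{s'} topFactor_s(η, s') · ρ(rest)) / N`. -/
noncomputable def Fcl (β : ℝ) (b m s : ℕ) (η : LGConfig 4 G) : ℝ :=
  ((ρ (col b η) * ((List.range m).map (topFactor ρ β b s η)).prod * ρ (rest b m η)).trace / (N : ℂ)).re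

/-- The prefix `ρ(col) · M_{top 0} ⋯ M_{top (s−1)}`. -/
noncomputable def Ppre (β : ℝ) (b s : ℕ) (η : LGConfig 4 G) : Matrix (Fin N) (Fin N) ℂ :=
  ρ (col b η) * ((List.range s).map fun s' => linkMean ρ β (topLink b s') η).prod

/-- The suffix `ρ(U_{top (s+1)}) ⋯ ρ(U_{top (m−1)}) · ρ(rest)`. -/
noncomputable def Qsuf (b m s : ℕ) (η : LGConfig 4 G) : Matrix (Fin N) (Fin N) ℂ :=
  ((List.range (m - (s + 1))).map fun i => ρ (η (topLink b (s + 1 + i)))).prod * ρ (rest b m η)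

omit [SecondCountableTopology G] in
theorem Fcl_zero (β : ℝ) (b m : ℕ) (η : LGConfig 4 G) : Fcl ρ β b m 0 η = loopObs ρ b m η := by
  have h : (List.range m).map (topFactor ρ β b 0 η) =
      ((List.range m).map fun s' => η (topLink b s')).map ρ := by
    rw [List.map_map]
    refine List.map_congr_left fun s' _ => ?_
    simp [topFactor]
  unfold Fcl loopObs chargedTest
  rw [h, ← map_list_prod, ← map_mul, ← map_mul, staple_eq_top_mul_rest, mul_assoc]

omit [SecondCountableTopology G] in
theorem Fcl_glue (β : ℝ) {b m s : ℕ} (hs : s < m) (η : LGConfig 4 G)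
    (ζ : ↥({topLink b s} : Finset (ZdEdge 4)) → G) :
    Fcl ρ β b m s (glueWith {topLink b s} ζ η) =
      ((Ppre ρ β b s η * ρ (ζ (theEdge _)) * Qsuf ρ b m s η).trace / (N : ℂ)).re := by
  rw [glueWith_singleton]
  set g := ζ (theEdge (topLink b s))
  unfold Fcl Ppre Qsuf
  rw [col_update_topLink, rest_update_topLink, prod_map_range_split _ hs]
  have h1 : (List.range s).map (topFactor ρ β b s (Function.update η (topLink b s) g)) =
      (List.range s).map fun s' => linkMean ρ β (topLink b s') η := by
    refine List.map_congr_left fun s' hs' => ?_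
    have hs's : s' < s := List.mem_range.1 hs'
    simp only [topFactor, hs's, if_true]
    exact linkMean_update_topLink ρ hs's.ne' β η g
  have h2 : topFactor ρ β b s (Function.update η (topLink b s) g) s = ρ g := by
    simp [topFactor]
  have h3 : ((List.range (m - (s + 1))).map fun i =>
        topFactor ρ β b s (Function.update η (topLink b s) g) (s + 1 + i)) =
      (List.range (m - (s + 1))).map fun i => ρ (η (topLink b (s + 1 + i))) := by
    refine List.map_congr_left fun i _ => ?_
    have : ¬ (s + 1 + i < s) := by omega
    simp only [topFactor, this, if_false]
    rw [Function.update_of_ne ((topLink_injective b).ne (by omega))]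
  rw [h1, h2, h3]
  simp only [mul_assoc]

omit [SecondCountableTopology G] in
theorem Fcl_succ (β : ℝ) {b m s : ℕ} (hs : s < m) (η : LGConfig 4 G) :
    Fcl ρ β b m (s + 1) η =
      ((Ppre ρ β b s η * linkMean ρ β (topLink b s) η * Qsuf ρ b m s η).trace / (N : ℂ)).re := by
  unfold Fcl Ppre Qsuf
  rw [prod_map_range_split _ hs]
  have h1 : (List.range s).map (topFactor ρ β b (s + 1) η) =
      (List.range s).map fun s' => linkMean ρ β (topLink b s') η := by
    refine List.map_congr_left fun s' hs' => ?_
    have : s' < s + 1 := by have := List.mem_range.1 hs'; omega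
    simp [topFactor, this]
  have h2 : topFactor ρ β b (s + 1) η s = linkMean ρ β (topLink b s) η := by simp [topFactor]
  have h3 : ((List.range (m - (s + 1))).map fun i => topFactor ρ β b (s + 1) η (s + 1 + i)) =
      (List.range (m - (s + 1))).map fun i => ρ (η (topLink b (s + 1 + i))) := by
    refine List.map_congr_left fun i _ => ?_
    have : ¬ (s + 1 + i < s + 1) := by omega
    simp [topFactor, this]
  rw [h1, h2, h3]
  simp only [mul_assoc]

/-- **Pointwise bound at the end of the top run**: after all `m` top links have been resampled,
`|F_m(η)| ≤ (1 − c/(2β))^m` (every factor `M_{top s}` contracts, `ρ(col)`, `ρ(rest)` are unitary). -/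
theorem abs_Fcl_top_le (hρ : Continuous ρ) (hρu : ∀ g, ρ g ∈ Matrix.unitaryGroup (Fin N) ℂ)
    {a₀ K₀ : ℝ} (hmob : MobilePairs ρ a₀ K₀) {β : ℝ} (hβ : 1 ≤ β) (b m : ℕ) (η : LGConfig 4 G) :
    |Fcl ρ β b m m η| ≤ (1 - ceilC N a₀ K₀ / (2 * β)) ^ m := by
  have hθ0 : 0 ≤ 1 - ceilC N a₀ K₀ / (2 * β) := by
    have h1 := ceilC_le_one N a₀ K₀
    have : ceilC N a₀ K₀ / (2 * β) ≤ 1 / 2 := by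
      rw [div_le_div_iff₀ (by linarith) (by norm_num)]; linarith
    linarith
  have hlist : IsContr (((List.range m).map (topFactor ρ β b m η)).prod)
      ((1 - ceilC N a₀ K₀ / (2 * β)) ^ m) := by
    have h := isContr_list_prod hθ0 ((List.range m).map (topFactor ρ β b m η)) (fun A hA => ?_)
    · simpa using h
    · obtain ⟨s', hs', rfl⟩ := List.mem_map.1 hA
      have : s' < m := List.mem_range.1 hs'
      simp only [topFactor, this, if_true]
      exact linkMean_isContr ρ hρ hρu hmob hβ _ _
  have hall : IsContr (ρ (col b η) * ((List.range m).map (topFactor ρ β b m η)).prod * ρ (rest b m η))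
      (1 * (1 - ceilC N a₀ K₀ / (2 * β)) ^ m * 1) :=
    ((isContr_of_unitary (hρu _)).mul hlist zero_le_one).mul (isContr_of_unitary (hρu _))
      (by positivity)
  have := abs_re_trace_div_le_of_isContr hall (by positivity)
  unfold Fcl
  simpa using this

/-! ### B.4 The DLR iteration `F_{s+1} = γ_{top s} F_s` on the torus -/

/-- The iterated single-link resampling of the loop observable along the top run. -/
noncomputable def Fit (β : ℝ) (b m : ℕ) : ℕ → LGConfig 4 G → ℝ
  | 0 => loopObs ρ b m
  | s + 1 => fun η => ∫ U, Fit β b m s U ∂(ymSpecification ρ β {topLink b s} η)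

omit [SecondCountableTopology G] in
theorem Fit_zero (β : ℝ) (b m : ℕ) : Fit ρ β b m 0 = loopObs ρ b m := rfl

omit [SecondCountableTopology G] in
theorem Fit_succ (β : ℝ) (b m s : ℕ) (η : LGConfig 4 G) :
    Fit ρ β b m (s + 1) η = ∫ U, Fit ρ β b m s U ∂(ymSpecification ρ β {topLink b s} η) := rfl

theorem continuous_Fit_and_bound (hρ : Continuous ρ) (hρu : ∀ g, ρ g ∈ Matrix.unitaryGroup (Fin N) ℂ)
    (β : ℝ) (b m : ℕ) : ∀ s, Continuous (Fit ρ β b m s) ∧ ∀ U, |Fit ρ β b m s U| ≤ 1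
  | 0 => ⟨continuous_loopObs ρ hρ b m, abs_loopObs_le ρ hρu b m⟩
  | s + 1 => by
    obtain ⟨hc, hb⟩ := continuous_Fit_and_bound hρ hρu β b m s
    exact ⟨continuous_integral_ymSpecification ρ hρ β _ hc hb,
      abs_integral_ymSpecification_le ρ hρ β _ hb⟩

/-- The support of `F_s`: the loop and the collars of the resampled links. -/
def supp (b m s : ℕ) : Finset (ZdEdge 4) :=
  loopEdges b m ∪ (Finset.range s).biUnion fun s' =>
    (plaquettesTouching ({topLink b s'} : Finset (ZdEdge 4))).biUnion plaquetteEdges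

omit [Group G] [TopologicalSpace G] [IsTopologicalGroup G] [CompactSpace G] [SecondCountableTopology G]
  [MeasurableSpace G] [BorelSpace G] in
theorem supp_succ (b m s : ℕ) : supp b m (s + 1) =
    supp b m s ∪ (plaquettesTouching ({topLink b s} : Finset (ZdEdge 4))).biUnion plaquetteEdges := by
  rw [supp, supp, Finset.range_add_one, Finset.biUnion_insert, Finset.union_assoc,
    Finset.union_comm ((Finset.range s).biUnion _)]

theorem Fit_isCylinder (hρ : Continuous ρ) (hρu : ∀ g, ρ g ∈ Matrix.unitaryGroup (Fin N) ℂ)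
    (β : ℝ) (b m : ℕ) : ∀ s, IsCylinder (Fit ρ β b m s) (supp b m s)
  | 0 => by
    rw [Fit_zero]
    have : supp b m 0 = loopEdges b m := by simp [supp]
    rw [this]
    exact loopObs_isCylinder ρ b m
  | s + 1 => by
    have h := dependsOn_integral_ymSpecification ρ hρ β {topLink b s}
      (continuous_Fit_and_bound ρ hρ hρu β b m s).1.measurable (Fit_isCylinder hρ hρu β b m s)
    rw [supp_succ]
    exact h

omit [Group G] [TopologicalSpace G] [IsTopologicalGroup G] [CompactSpace G] [SecondCountableTopology G]
  [MeasurableSpace G] [BorelSpace G] in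
theorem supp_mem_box {b n s : ℕ} (hb : 1 ≤ b) (hs : s ≤ (2 * n + 1) * b) :
    ∀ e ∈ supp b ((2 * n + 1) * b) s, e.1 ∈ box 4 ((2 * n + 2) * b + 1) := by
  intro e he
  rcases Finset.mem_union.1 he with he | he
  · exact loopEdges_mem_box (b := b) (n := n) (m := (2 * n + 1) * b) (by push_cast; ring) e he
  · obtain ⟨s', hs', he'⟩ := Finset.mem_biUnion.1 he
    have hs'm : s' < (2 * n + 1) * b := lt_of_lt_of_le (Finset.mem_range.1 hs') hs
    exact topLink_collar_mem_box hb hs'm e (Finset.mem_union_right _ he')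

/-- **DLR chain on the torus**: `∫ W_C ∘ lift dμ = ∫ F_s ∘ lift dμ` for every `s ≤ m`. -/
theorem integral_torus_Fit (hρ : Continuous ρ) (hρu : ∀ g, ρ g ∈ Matrix.unitaryGroup (Fin N) ℂ)
    (β : ℝ) {b : ℕ} (hb : 1 ≤ b) (n : ℕ) :
    ∀ s, s ≤ (2 * n + 1) * b →
      ∫ V, loopObs ρ b ((2 * n + 1) * b) (torusLift (2 * ((2 * n + 2) * b + 1) + 1) V)
          ∂(wilsonMeasure (d := 4) (L := 2 * ((2 * n + 2) * b + 1) + 1) ρ β) =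
        ∫ V, Fit ρ β b ((2 * n + 1) * b) s (torusLift (2 * ((2 * n + 2) * b + 1) + 1) V)
          ∂(wilsonMeasure (d := 4) (L := 2 * ((2 * n + 2) * b + 1) + 1) ρ β)
  | 0, _ => rfl
  | s + 1, hs => by
    rw [integral_torus_Fit hρ hρu β hb n s (Nat.le_of_succ_le hs)]
    obtain ⟨hc, hbd⟩ := continuous_Fit_and_bound ρ hρ hρu β b ((2 * n + 1) * b) s
    exact integral_torusLift_eq_integral_ymSpecification ρ hρ β {topLink b s} hc hbd
      (Fit_isCylinder ρ hρ hρu β b _ s) (topLink_collar_mem_box hb (Nat.lt_of_succ_le hs))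
      (supp_mem_box hb (Nat.le_of_succ_le hs))

/-- **Closed form**: `F_s = Fcl_s` for `s ≤ m` (induction; the step is the single-link integral
`∫ Re tr(P ρ(g) Q)/N · w dHaar / ∫ w dHaar = Re tr(P M Q)/N`). -/
theorem Fit_eq_Fcl (hρ : Continuous ρ) (hρu : ∀ g, ρ g ∈ Matrix.unitaryGroup (Fin N) ℂ)
    (β : ℝ) (b m : ℕ) : ∀ s, s ≤ m → Fit ρ β b m s = Fcl ρ β b m s
  | 0, _ => by funext η; exact (Fcl_zero ρ β b m η).symm
  | s + 1, hs => by
    have hs' : s < m := Nat.lt_of_succ_le hs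
    have IH := Fit_eq_Fcl hρ hρu β b m s hs'.le
    have hmeas : Measurable (Fcl ρ β b m s) :=
      IH ▸ (continuous_Fit_and_bound ρ hρ hρu β b m s).1.measurable
    funext η
    rw [Fit_succ, IH, integral_ymSpecification ρ hρ β {topLink b s} hmeas η, Fcl_succ ρ β hs' η]
    simp only [Fcl_glue ρ β hs' η]
    have hZ := integral_linkW_pos ρ hρ β (topLink b s) η
    have hwC : Continuous fun ζ : ↥({topLink b s} : Finset (ZdEdge 4)) → G =>
        (linkW ρ β (topLink b s) η ζ : ℂ) :=
      Complex.continuous_ofReal.comp (continuous_linkW ρ hρ β (topLink b s) η)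
    have hint : ∀ i j, Integrable (fun ζ => linkRep ρ (topLink b s) ζ i j *
        (linkW ρ β (topLink b s) η ζ : ℂ)) (linkPi (topLink b s)) :=
      fun i j => integrable_of_continuous_compact _
        (((continuous_linkRep ρ hρ (topLink b s)).matrix_elem i j).mul hwC)
    have htr : Integrable (fun ζ => (Ppre ρ β b s η * linkRep ρ (topLink b s) ζ * Qsuf ρ b m s η).trace *
        (linkW ρ β (topLink b s) η ζ : ℂ)) (linkPi (topLink b s)) :=
      integrable_of_continuous_compact _
        (((continuous_const.matrix_mul (continuous_linkRep ρ hρ (topLink b s))).matrix_mul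
          continuous_const).matrix_trace.mul hwC)
    have key := integral_re_trace_mul (linkPi (topLink b s)) (linkRep ρ (topLink b s))
      (linkW ρ β (topLink b s) η) hint hZ.ne' (Ppre ρ β b s η) (Qsuf ρ b m s η) htr
    simp only [linkRep_apply, linkW] at key
    unfold linkMean
    rw [key]
    exact mul_div_cancel_left₀ _ hZ.ne'

/-- **PERIMETER-LAW UPPER BOUND (finite volume, non-abelian, rate `c/β`).**  For every continuous
unitary `ρ` with `MobilePairs ρ a₀ K₀`, every `β ≥ 1`, `b ≥ 1`, `n`, the torus expectation of the
`b × (2n+1)b` rectangle Wilson loop is at most `(1 − c/(2β))^{(2n+1)b}`, `c = ceilC N a₀ K₀`. -/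
theorem integral_loopObs_torus_le_pow (hρ : Continuous ρ) (hρu : ∀ g, ρ g ∈ Matrix.unitaryGroup (Fin N) ℂ)
    {a₀ K₀ : ℝ} (hmob : MobilePairs ρ a₀ K₀) {β : ℝ} (hβ : 1 ≤ β) {b : ℕ} (hb : 1 ≤ b) (n : ℕ) :
    ∫ V, loopObs ρ b ((2 * n + 1) * b) (torusLift (2 * ((2 * n + 2) * b + 1) + 1) V)
        ∂(wilsonMeasure (d := 4) (L := 2 * ((2 * n + 2) * b + 1) + 1) ρ β) ≤
      (1 - ceilC N a₀ K₀ / (2 * β)) ^ ((2 * n + 1) * b) := by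
  set m := (2 * n + 1) * b with hm
  set L := (2 * n + 2) * b + 1 with hL
  haveI := isProbabilityMeasure_wilsonMeasure (d := 4) (L := 2 * L + 1) (G := G) ρ hρ β
  rw [integral_torus_Fit ρ hρ hρu β hb n m le_rfl, Fit_eq_Fcl ρ hρ hρu β b m m le_rfl]
  have hpt : ∀ V : GaugeConfig 4 (2 * L + 1) G,
      Fcl ρ β b m m (torusLift (2 * L + 1) V) ≤ (1 - ceilC N a₀ K₀ / (2 * β)) ^ m :=
    fun V => (le_abs_self _).trans (abs_Fcl_top_le ρ hρ hρu hmob hβ b m _)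
  have hmeas : Measurable (Fcl ρ β b m m) :=
    (Fit_eq_Fcl ρ hρ hρu β b m m le_rfl) ▸ (continuous_Fit_and_bound ρ hρ hρu β b m m).1.measurable
  have hint : Integrable (fun V : GaugeConfig 4 (2 * L + 1) G => Fcl ρ β b m m (torusLift (2 * L + 1) V))
      (wilsonMeasure (d := 4) (L := 2 * L + 1) ρ β) := by
    refine integrable_of_bound (hmeas.comp (measurable_torusLift _)).aestronglyMeasurable
      (C := (1 - ceilC N a₀ K₀ / (2 * β)) ^ m) fun V => ?_
    have := Fit_eq_Fcl ρ hρ hρu β b m m le_rfl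
    exact abs_Fcl_top_le ρ hρ hρu hmob hβ b m _
  calc ∫ V, Fcl ρ β b m m (torusLift (2 * L + 1) V) ∂(wilsonMeasure (d := 4) (L := 2 * L + 1) ρ β)
      ≤ ∫ V, (1 - ceilC N a₀ K₀ / (2 * β)) ^ m ∂(wilsonMeasure (d := 4) (L := 2 * L + 1) ρ β) :=
        integral_mono hint (integrable_const _) hpt
    _ = (1 - ceilC N a₀ K₀ / (2 * β)) ^ m := by simp

end Lattice

/-! ## §C. THE CEILING: annealed loop freezing cannot persist beyond `b ~ β` -/

section Ceiling

open Summit.QuantumFields.YangMills.Cruxes.IR.FixedMesh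
open Summit.QuantumFields.YangMills.Cruxes.IR.RowFloorPoly (LoopFreezingPoly)

variable {G : Type} [Group G] [TopologicalSpace G] [IsTopologicalGroup G] [CompactSpace G]
  [SecondCountableTopology G] [MeasurableSpace G] [BorelSpace G]
  {N : ℕ} (ρ : G →* Matrix (Fin N) (Fin N) ℂ)

/-- Elementary: `e^{-1} < 1/2`. -/
theorem exp_neg_one_lt_half : Real.exp (-1) < 1 / 2 := by
  have h : (2 : ℝ) < Real.exp 1 := by
    have := Real.add_one_lt_exp (x := (1 : ℝ)) one_ne_zero
    linarith
  have h2 := one_div_lt_one_div_of_lt (by norm_num : (0 : ℝ) < 2) h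
  rwa [Real.exp_neg, ← one_div]

/-- **THE FREEZING CEILING (θ > 1 is impossible).**  For every continuous unitary `ρ` with the
Lie-free mobility property `MobilePairs ρ a₀ K₀` and every `n`, the INPUT `LoopFreezingPoly ρ n θ`
of the polynomial row floor (tree `Theorems/IR/Negative/TypOnsetFloorPoly/Poly.lean`) FAILS for
every exponent `θ > 1`: annealed `b × (2n+1)b` loop freezing `E W ≥ 1 − η` cannot hold along
`b ≤ c (β / log β)^θ`, because `E W ≤ (1 − c(ρ)/(2β))^{(2n+1)b} ≤ e^{−c(ρ) b/(2β)}`.  Hence every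
floor manufactured from loop freezing by the GEN 6/7 reduction saturates at `b⋆ = O(β)` (up to
logarithms): the ladder `1/7 → 1/4 → …` of that mechanism has the CEILING `θ ≤ 1`. -/
theorem not_loopFreezingPoly_of_one_lt (hρ : Continuous ρ) (hρu : ∀ g, ρ g ∈ Matrix.unitaryGroup (Fin N) ℂ)
    {a₀ K₀ : ℝ} (hmob : MobilePairs ρ a₀ K₀) (n : ℕ) {θ : ℝ} (hθ : 1 < θ) :
    ¬ LoopFreezingPoly ρ n θ := by
  intro hF
  obtain ⟨c₁, hc₁, β₀, H⟩ := hF (1 / 2) (by norm_num)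
  obtain ⟨c, hc_def⟩ : ∃ c : ℝ, c = ceilC N a₀ K₀ := ⟨_, rfl⟩
  have hc : 0 < c := hc_def ▸ ceilC_pos N hmob.1 K₀
  have hc1 : c ≤ 1 := hc_def ▸ ceilC_le_one N a₀ K₀
  -- exponents
  have hθ0 : 0 < θ := by linarith
  have hθne : θ ≠ 0 := hθ0.ne'
  obtain ⟨ε, hε_def⟩ : ∃ ε : ℝ, ε = (θ - 1) / (2 * θ) := ⟨_, rfl⟩
  obtain ⟨p, hp_def⟩ : ∃ p : ℝ, p = (θ - 1) / 2 := ⟨_, rfl⟩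
  have hε : 0 < ε := by rw [hε_def]; exact div_pos (by linarith) (by linarith)
  have hεne : ε ≠ 0 := hε.ne'
  have hp : 0 < p := by rw [hp_def]; linarith
  have hεθ : (1 - ε) * θ = 1 + p := by rw [hε_def, hp_def]; field_simp; ring
  have hεθpos : 0 < ε ^ θ := Real.rpow_pos_of_pos hε θ
  -- choose β large
  obtain ⟨R, hR⟩ : ∃ R : ℝ, R = (2 / c + 1) / (c₁ * ε ^ θ) := ⟨_, rfl⟩
  obtain ⟨β, hβ1, hβ2⟩ := ((Filter.eventually_ge_atTop (max β₀ 3)).and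
    ((tendsto_rpow_atTop hp).eventually_ge_atTop R)).exists
  have hβ₀ : β₀ ≤ β := (le_max_left _ _).trans hβ1
  have hβ3 : (3 : ℝ) ≤ β := (le_max_right _ _).trans hβ1
  have hβ0 : 0 < β := by linarith
  have hβ1' : (1 : ℝ) ≤ β := by linarith
  have hlog : 0 < Real.log β := Real.log_pos (by linarith)
  -- the lower bound on `X = (β / log β)^θ`
  obtain ⟨X, hX_def⟩ : ∃ X : ℝ, X = (β / Real.log β) ^ θ := ⟨_, rfl⟩
  have hX0 : 0 ≤ X := hX_def ▸ Real.rpow_nonneg (div_nonneg hβ0.le hlog.le) θ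
  have hXlb : ε ^ θ * (β * β ^ p) ≤ X := by
    have h1 : ε * β ^ (1 - ε) ≤ β / Real.log β := by
      have hl : Real.log β ≤ β ^ ε / ε := Real.log_le_rpow_div hβ0.le hε
      rw [le_div_iff₀ hlog]
      calc ε * β ^ (1 - ε) * Real.log β ≤ ε * β ^ (1 - ε) * (β ^ ε / ε) :=
            mul_le_mul_of_nonneg_left hl (by positivity)
        _ = β ^ (1 - ε) * β ^ ε := by field_simp
        _ = β := by rw [← Real.rpow_add hβ0]; simp
    have h2 := Real.rpow_le_rpow (by positivity) h1 hθ0.le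
    rw [Real.mul_rpow hε.le (by positivity), ← Real.rpow_mul hβ0.le, hεθ, Real.rpow_add hβ0,
      Real.rpow_one, ← hX_def] at h2
    exact h2
  -- `c₁ X ≥ 2β/c + 1`
  have hkey : 2 * β / c + 1 ≤ c₁ * X := by
    have hβp : R ≤ β ^ p := hβ2
    have h1 : 2 / c + 1 ≤ c₁ * ε ^ θ * β ^ p := by
      rw [hR, div_le_iff₀ (by positivity)] at hβp; linarith
    have h3 : β * (2 / c + 1) ≤ c₁ * (ε ^ θ * (β * β ^ p)) := by
      have := mul_le_mul_of_nonneg_left h1 hβ0.le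
      calc β * (2 / c + 1) ≤ β * (c₁ * ε ^ θ * β ^ p) := this
        _ = c₁ * (ε ^ θ * (β * β ^ p)) := by ring
    have h4 : c₁ * (ε ^ θ * (β * β ^ p)) ≤ c₁ * X := mul_le_mul_of_nonneg_left hXlb hc₁.le
    have h5 : β * (2 / c + 1) = 2 * β / c + β := by ring
    linarith
  -- the width `b = ⌊c₁ X⌋`
  obtain ⟨b, hb_def⟩ : ∃ b : ℕ, b = ⌊c₁ * X⌋₊ := ⟨_, rfl⟩
  have hbX : (b : ℝ) ≤ c₁ * X := hb_def ▸ Nat.floor_le (by positivity)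
  have hblt : c₁ * X < b + 1 := hb_def ▸ Nat.lt_floor_add_one _
  have hbβ : 2 * β / c ≤ b := by linarith
  have hb1 : 1 ≤ b := by
    have : (0 : ℝ) < b := lt_of_lt_of_le (by positivity) hbβ
    exact Nat.succ_le_of_lt (by exact_mod_cast this)
  -- freezing from below, the perimeter law from above
  have hlow := H β hβ₀ b hb1 (hX_def ▸ hbX)
  simp only at hlow
  have hup := integral_loopObs_torus_le_pow ρ hρ hρu hmob hβ1' hb1 n
  rw [← hc_def] at hup
  have hu0 : 0 ≤ c / (2 * β) := by positivity
  have hu1 : c / (2 * β) ≤ 1 := by rw [div_le_one (by positivity)]; linarith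
  have hpow : (1 - c / (2 * β)) ^ ((2 * n + 1) * b) ≤ Real.exp (-1) := by
    have h1 : (1 - c / (2 * β)) ^ ((2 * n + 1) * b) ≤ Real.exp (-(c / (2 * β))) ^ ((2 * n + 1) * b) :=
      pow_le_pow_left₀ (by linarith) (by have := Real.add_one_le_exp (-(c / (2 * β))); linarith) _
    rw [← Real.exp_nat_mul] at h1
    refine h1.trans (Real.exp_le_exp.2 ?_)
    have hub : 1 ≤ c / (2 * β) * b := by
      have h2 : 2 * β ≤ c * b := by
        have := mul_le_mul_of_nonneg_left hbβ hc.le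
        calc 2 * β = c * (2 * β / c) := by field_simp
          _ ≤ c * b := this
      rw [div_mul_eq_mul_div, le_div_iff₀ (by positivity)]
      linarith
    have hn0 : (0 : ℝ) ≤ n := Nat.cast_nonneg n
    have hb0 : (0 : ℝ) ≤ b := Nat.cast_nonneg b
    have hmb : (b : ℝ) ≤ (((2 * n + 1) * b : ℕ) : ℝ) := by push_cast; nlinarith
    nlinarith [mul_nonneg hu0 (sub_nonneg.2 hmb)]
  have := exp_neg_one_lt_half
  linarith

/-- Corollary (the ceiling as an inequality): if the annealed loop-freezing input holds with
exponent `θ` for a mobile `ρ`, then `θ ≤ 1`. -/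
theorem loopFreezingPoly_exponent_le_one (hρ : Continuous ρ)
    (hρu : ∀ g, ρ g ∈ Matrix.unitaryGroup (Fin N) ℂ) {a₀ K₀ : ℝ} (hmob : MobilePairs ρ a₀ K₀)
    {n : ℕ} {θ : ℝ} (h : LoopFreezingPoly ρ n θ) : θ ≤ 1 :=
  not_lt.1 fun hθ => not_loopFreezingPoly_of_one_lt ρ hρ hρu hmob n hθ h

end Ceiling

/-! ## §D. Anti-vacuity of the hypothesis: `U(1)` is mobile (`a₀ = 2/π`, `K₀ = 1`) -/

section Witness

open Literature.MathematicalPhysics.QuantumLattice (u1Rep u1Rep_apply)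

theorem act_u1Rep (k : Circle) (x : EuclideanSpace ℂ (Fin 1)) : act (u1Rep k) x = (k : ℂ) • x := by
  have : u1Rep k = (k : ℂ) • (1 : Matrix (Fin 1) (Fin 1) ℂ) := by
    rw [u1Rep_apply, Matrix.scalar_apply, Matrix.smul_one_eq_diagonal]
  rw [this, smul_act, act_one]

/-- **`U(1)` (defining representation) has `MobilePairs` with `a₀ = 2/π`, `K₀ = 1`**: at scale `t`
take `k = e^{it}`; `|e^{it} − 1| = 2 sin(t/2) ≥ (2/π) t` and `|2 cos t − 2| ≤ t²`.  So the ceiling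
`not_loopFreezingPoly_of_one_lt` is not vacuous. -/
theorem mobilePairs_u1Rep : MobilePairs u1Rep (2 / Real.pi) 1 := by
  refine ⟨by positivity, zero_le_one, fun x t ht0 ht1 => ⟨Circle.exp t, ?_, fun v => ?_⟩⟩
  · rw [act_u1Rep, show ((Circle.exp t : Circle) : ℂ) • x - x = (((Circle.exp t : Circle) : ℂ) - 1) • x by
      rw [sub_smul, one_smul], norm_smul, Circle.coe_exp,
      show (t : ℂ) * Complex.I = Complex.I * t by ring, Complex.norm_exp_I_mul_ofReal_sub_one]
    have hsin : 2 / Real.pi * (t / 2) ≤ Real.sin (t / 2) :=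
      Real.mul_le_sin (by linarith) (by linarith [Real.pi_gt_three])
    have hs0 : 0 ≤ Real.sin (t / 2) := le_trans (by positivity) hsin
    rw [Real.norm_eq_abs, abs_of_nonneg (by linarith)]
    exact mul_le_mul_of_nonneg_right (by linarith) (norm_nonneg x)
  · rw [act_u1Rep, act_u1Rep, ← add_smul, ← sub_smul, Circle.coe_inv_eq_conj, Complex.add_conj,
      norm_smul]
    have hre : ((Circle.exp t : Circle) : ℂ).re = Real.cos t := by
      rw [Circle.coe_exp, Complex.exp_ofReal_mul_I_re]
    rw [hre, show ((2 * Real.cos t : ℝ) : ℂ) - 2 = ((2 * Real.cos t - 2 : ℝ) : ℂ) by push_cast; ring,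
      Complex.norm_real, Real.norm_eq_abs]
    have hc1 : Real.cos t ≤ 1 := Real.cos_le_one t
    have hc2 : 1 - t ^ 2 / 2 ≤ Real.cos t := Real.one_sub_sq_div_two_le_cos
    rw [abs_of_nonpos (by linarith), one_mul]
    exact mul_le_mul_of_nonneg_right (by linarith) (norm_nonneg v)

end Witness

end Summit.QuantumFields.YangMills.Cruxes.IR.CruxIdea2g9
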